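import Literature.NumberTheory.Sieve.CircleMethodMajorArcs
import Literature.NumberTheory.Sieve.CircleMethodMajorArcsProofs
import Literature.NumberTheory.Sieve.CircleMethodProofs
import Literature.NumberTheory.Sieve.CircleMethodKernel
import Literature.NumberTheory.Sieve.GoldbachSingularSeriesSum
import Mathlib.Analysis.SpecialFunctions.Pow.Real
import Mathlib.Analysis.SpecialFunctions.Log.Basic
import Mathlib.MeasureTheory.Integral.IntervalIntegral.Periodic
import Mathlib.Analysis.Complex.ExponentialBounds
import HarnessLib

/-!
# Proof of Matomäki–Radziwiłł–Tao 2019, Prop. 3.3(i), from Prop. 4.1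

Trunk AntSieve / family `parity`, topic `Literature/NumberTheory/Sieve`. This file proves

  `theorem MatomakiRadziwillTao2019_prop33i_of_prop41 :
     MatomakiRadziwillTao2019_prop41 → MatomakiRadziwillTao2019_prop33i`

i.e. the named fact `Literature.NumberTheory.Sieve.MatomakiRadziwillTao2019_prop33i` (major arcs for the Hardy–Littlewood
prime-pair conjecture, `Literature/NumberTheory/Sieve/CircleMethodMajorArcs.lean`) is reduced to the
named fact `Literature.NumberTheory.Sieve.MatomakiRadziwillTao2019_prop41` (the Siegel–Walfisz major-arc asymptotic for the
prime exponential sum, same file), following the printed proof (arXiv:1707.01315, §4, pp. 20–21)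
step by step. Prop. 4.1 itself rests on the Siegel–Walfisz theorem (`Literature.NumberTheory.Sieve.siegel_walfisz`,
not available in Mathlib) and is reduced to it in `CircleMethodMajorArcsProofs.lean`
(`Literature.NumberTheory.Sieve.MatomakiRadziwillTao2019_prop41_of_siegelWalfisz`); composing the two gives

  `theorem MatomakiRadziwillTao2019_prop33i_of_siegelWalfisz :
     Literature.Parity.siegel_walfisz → MatomakiRadziwillTao2019_prop33i`.

Hence `MatomakiRadziwillTao2019_prop33i_holds` is not asserted: it is exactly as far away as a
discharge of `Literature.NumberTheory.Sieve.siegel_walfisz` (zero-free region for Dirichlet `L`-functions + Siegel's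
theorem).

## Structure of the proof (MRT pp. 20–21 ↔ Lean)

1. *Pointwise approximation on an arc* ("From Proposition 4.1 and the crude bound
   `S_{Λ1_{(X,2X]}}(α) ≪ X` … `|S|² = μ²(q)/φ²(q) |∫_X^{2X} e(βx)dx|² + O(X² log^{-A'} X)`"):
   `primeExpSumDyadic_approx`, `normSq_primeExpSumDyadic_approx`. We use the *sum* kernel
   `T_{X,2X}(β) = ∑_{X<n≤2X} e(nβ)` (`Literature.NumberTheory.Sieve.expSumIoc`) in place of `∫_X^{2X} e(βx) dx`; the two differ
   by `≤ 2π|β|X ≤ 2π log^{B'} X` (`Literature.NumberTheory.Sieve.norm_expSumIoc_sub_integral_le`), which is absorbed.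
2. *Measure of the major arcs* ("has measure `O(X^{-1} log^{2B+B'} X)`"): `volume_real_majorArcs_le`,
   and the decomposition of `∫_𝔐` into the (disjoint, `Literature.NumberTheory.Sieve.pairwiseDisjoint_majorArc_holds`) arcs:
   `integral_majorArcs_eq_sum`; summed error `integral_majorArcs_hlIntegrand_approx`.
3. *The kernel integral* (MRT eq. (20), via Fourier inversion): replaced by the exact orthogonality
   computation `∫_{-1/2}^{1/2} |T(β)|² e(βh) dβ = X - |h|` and the tail bound `|T(β)| ≤ 1/(2|β|)`
   (`Literature.NumberTheory.Sieve.norm_integral_expSumIocSqKernel_sub_le` in `CircleMethodKernel.lean`).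
4. *Ramanujan sums* ("the left-hand side simplifies to `∑_{q ≤ log^B X} μ²(q)c_q(h)/φ²(q)`"):
   `sum_integral_arcModel` (the two half-arcs at `0/1` and `1/1` of `Literature.NumberTheory.Sieve.majorArcs` merge by
   periodicity), with `c_q(h)` from `RamanujanSum.lean`.
5. *Singular series* (tail `≪ d₂(h)^{O(1)} log^{-B/2} X` and `∑_q μ² c_q(h)/φ² = 𝔖(h)`):
   `Literature.NumberTheory.Sieve.abs_goldbachSingularSeries_sub_sum_le`, `Literature.NumberTheory.Sieve.hasSum_goldbachSeriesTerm`
   (`GoldbachSingularSeriesSum.lean`); the exponent `O(1)` is realised as `c = 2`.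
6. Large `X` (`prop33i_large`) and the crude bound for small `X`
   (`norm_integral_majorArcs_sub_le_crude`) give the fact with constants `C`, `c = 2`.

Finally `MatomakiRadziwillTao2019_prop41_dyadic` records the second ("hence also") display of
MRT Prop. 4.1 exactly as printed — the dyadic sum `S_{Λ1_{(X,2X]}}` against the integral kernel
`∫_X^{2X} e(βx) dx`, for all `X ≥ 2` — as a consequence of `MatomakiRadziwillTao2019_prop41`.

All intermediate declarations live in the namespace `Literature.PrimePairMajorArcs`; only the final
reduction theorems `MatomakiRadziwillTao2019_prop33i_of_…` are in `Literature`.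

## References

* K. Matomäki, M. Radziwiłł, T. Tao, *Correlations of the von Mangoldt and higher divisor
  functions I. Long shift ranges*, Proc. LMS 118 (2019) 284–350, arXiv:1707.01315: Prop. 3.3(i)
  p. 18, Prop. 4.1 p. 20, proof of Prop. 3.3(i) pp. 20–21 (arXiv pagination, `lit read`).
* R. C. Vaughan, *The Hardy–Littlewood Method*, 2nd ed. (1997), §3.1–3.2.
-/

noncomputable section

open scoped FourierTransform ArithmeticFunction.Moebius ArithmeticFunction
open Finset MeasureTheory ArithmeticFunction

namespace Literature.NumberTheory.Sieve

open CircleMethodKernel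

namespace PrimePairMajorArcs

/-! ### Growth lemma: powers of `log` against powers -/

/-- `(log x)^k ≤ (k/ε)^k x^ε` for `x ≥ 1`, `k, ε > 0`; packaged as `∃ K > 0, ∀ x ≥ 1, …`. This is
the explicit, global-constant form needed for the constants of Prop. 3.3(i); the eventual form
`∀ᶠ x, (log x)^r ≤ x^s` is `Literature.NumberTheory.Sieve.eventually_log_rpow_le_rpow`
(`BombieriVinogradovReduction.lean`). [folklore] -/
theorem exists_log_rpow_le_rpow {k ε : ℝ} (hk : 0 < k) (hε : 0 < ε) :
    ∃ K : ℝ, 0 < K ∧ ∀ x : ℝ, 1 ≤ x → Real.log x ^ k ≤ K * x ^ ε := by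
  refine ⟨(k / ε) ^ k, by positivity, fun x hx ↦ ?_⟩
  have hlog0 : 0 ≤ Real.log x := Real.log_nonneg hx
  have h1 : Real.log x ≤ x ^ (ε / k) / (ε / k) := Real.log_le_rpow_div (by linarith) (by positivity)
  have h2 : x ^ (ε / k) / (ε / k) = (k / ε) * x ^ (ε / k) := by
    field_simp
  rw [h2] at h1
  calc Real.log x ^ k ≤ ((k / ε) * x ^ (ε / k)) ^ k := Real.rpow_le_rpow hlog0 h1 hk.le
    _ = (k / ε) ^ k * x ^ ε := by
        rw [Real.mul_rpow (by positivity) (by positivity), ← Real.rpow_mul (by linarith),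
          div_mul_cancel₀ _ hk.ne']

/-- Eventual domination: `(log x)^k ≤ c·x` for all `x ≥ x₀(k, c)`, for any `k, c > 0`. [folklore] -/
theorem exists_log_rpow_le_mul {k c : ℝ} (hk : 0 < k) (hc : 0 < c) :
    ∃ x₀ : ℝ, 1 ≤ x₀ ∧ ∀ x : ℝ, x₀ ≤ x → Real.log x ^ k ≤ c * x := by
  obtain ⟨K, hK, h⟩ := exists_log_rpow_le_rpow hk (one_half_pos (α := ℝ))
  -- `(log x)^k ≤ K x^{1/2} ≤ c x` as soon as `x^{1/2} ≥ K/c`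
  refine ⟨max 1 ((K / c) ^ 2), le_max_left _ _, fun x hx ↦ ?_⟩
  have hx1 : 1 ≤ x := (le_max_left _ _).trans hx
  have hx2 : (K / c) ^ 2 ≤ x := (le_max_right _ _).trans hx
  have hsqrt : K / c ≤ x ^ (1 / 2 : ℝ) := by
    rw [← Real.sqrt_eq_rpow]
    exact Real.le_sqrt_of_sq_le hx2
  calc Real.log x ^ k ≤ K * x ^ (1 / 2 : ℝ) := h x hx1
    _ ≤ (c * x ^ (1 / 2 : ℝ)) * x ^ (1 / 2 : ℝ) := by
        have : K ≤ c * x ^ (1 / 2 : ℝ) := by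
          rw [div_le_iff₀ hc] at hsqrt; linarith
        gcongr
    _ = c * x := by
        rw [mul_assoc, ← Real.rpow_add (by linarith)]
        norm_num

/-! ### Geometry of the major arcs -/

/-- An interior major arc (`0 < a < q`, half-width `δ = P/N ≤ 1/q`) is the full interval
`[a/q - P/N, a/q + P/N]`. [folklore] -/
theorem majorArc_eq_Icc {N q : ℕ} {a : ℤ} {P : ℝ} (hq : 0 < q) (ha0 : 0 < a) (haq : a < q)
    (hδ : P / N ≤ 1 / q) :
    majorArc N q a P = Set.Icc ((a : ℝ) / q - P / N) ((a : ℝ) / q + P / N) := by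
  have hq' : (0 : ℝ) < q := by exact_mod_cast hq
  have h1 : (1 : ℝ) / q ≤ (a : ℝ) / q := by
    gcongr; exact_mod_cast ha0
  have h2 : (a : ℝ) / q ≤ 1 - 1 / q := by
    rw [div_le_iff₀ hq', sub_mul, one_div_mul_cancel hq'.ne', one_mul]
    have h' : a + 1 ≤ (q : ℤ) := haq
    have : (a : ℝ) + 1 ≤ q := by exact_mod_cast h'
    linarith
  ext α
  simp only [majorArc, Set.mem_setOf_eq, Set.mem_Icc, abs_le]
  constructor
  · rintro ⟨-, h3, h4⟩; constructor <;> linarith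
  · rintro ⟨h3, h4⟩; refine ⟨⟨by linarith, by linarith⟩, by linarith, by linarith⟩

/-- The major arc at `a = 0` is `[0, P/N]` (for `0 ≤ P/N ≤ 1`). [folklore] -/
theorem majorArc_zero {N q : ℕ} {P : ℝ} (hP : 0 ≤ P / N) (hδ : P / N ≤ 1) :
    majorArc N q 0 P = Set.Icc 0 (P / N) := by
  ext α
  simp only [majorArc, Set.mem_setOf_eq, Set.mem_Icc, Int.cast_zero, zero_div, sub_zero, abs_le]
  constructor
  · rintro ⟨⟨h1, -⟩, -, h3⟩; exact ⟨h1, h3⟩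
  · rintro ⟨h1, h3⟩; exact ⟨⟨h1, by linarith⟩, by linarith, h3⟩

/-- The major arc at `a = q = 1` is `[1 - P/N, 1]` (for `0 ≤ P/N ≤ 1`). [folklore] -/
theorem majorArc_one_one {N : ℕ} {P : ℝ} (hP : 0 ≤ P / N) (hδ : P / N ≤ 1) :
    majorArc N 1 1 P = Set.Icc (1 - P / N) 1 := by
  ext α
  simp only [majorArc, Set.mem_setOf_eq, Set.mem_Icc, Int.cast_one, Nat.cast_one, div_one, abs_le]
  constructor
  · rintro ⟨⟨-, h2⟩, h3, -⟩; exact ⟨by linarith, h2⟩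
  · rintro ⟨h1, h2⟩; exact ⟨⟨by linarith, h2⟩, by linarith, by linarith⟩

/-- Every major arc lies in an interval of length `2P/N`, so has measure `≤ 2P/N`. [folklore] -/
theorem volume_majorArc_le (N q : ℕ) (a : ℤ) (P : ℝ) :
    volume (majorArc N q a P) ≤ ENNReal.ofReal (2 * (P / N)) := by
  calc volume (majorArc N q a P)
      ≤ volume (Set.Icc ((a : ℝ) / q - P / N) ((a : ℝ) / q + P / N)) := by
        refine measure_mono fun α hα ↦ ?_
        have := hα.2
        rw [abs_le] at this
        exact ⟨by linarith [this.1], by linarith [this.2]⟩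
    _ = ENNReal.ofReal (2 * (P / N)) := by
        rw [Real.volume_Icc]; ring_nf

/-- The major arcs lie in `[0, 1]`. [folklore] -/
theorem majorArcs_subset_Icc (N : ℕ) (P Q : ℝ) : majorArcs N P Q ⊆ Set.Icc 0 1 := by
  intro α hα
  simp only [majorArcs, Set.mem_iUnion] at hα
  obtain ⟨q, -, a, -, hα⟩ := hα
  exact hα.1

/-- The index set of the major arcs as a `Finset` of pairs `⟨q, a⟩`. [folklore] -/
def majorArcIndex (Q : ℝ) : Finset (Σ _ : ℕ, ℕ) :=
  (Icc 1 ⌊Q⌋₊).sigma fun q ↦ (range (q + 1)).filter (fun a : ℕ ↦ a.Coprime q)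

/-- `majorArcs` as a union over `majorArcIndex`. [folklore] -/
theorem majorArcs_eq_biUnion (N : ℕ) (P Q : ℝ) :
    majorArcs N P Q = ⋃ i ∈ majorArcIndex Q, majorArc N i.1 (i.2 : ℤ) P := by
  rw [majorArcIndex, Set.biUnion_finsetSigma]
  rfl

/-- The number of major arcs is at most `∑_{q ≤ Q} (q + 1) ≤ 2Q²` (`Q ≥ 1`). [folklore] -/
theorem card_majorArcIndex_le {Q : ℝ} (hQ : 1 ≤ Q) : ((majorArcIndex Q).card : ℝ) ≤ 2 * Q ^ 2 := by
  have hQ0 : 0 ≤ Q := by linarith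
  have hfloor : (⌊Q⌋₊ : ℝ) ≤ Q := Nat.floor_le hQ0
  calc ((majorArcIndex Q).card : ℝ)
      = ∑ q ∈ Icc 1 ⌊Q⌋₊, (((range (q + 1)).filter (fun a : ℕ ↦ a.Coprime q)).card : ℝ) := by
        rw [majorArcIndex, card_sigma]; push_cast; rfl
    _ ≤ ∑ q ∈ Icc 1 ⌊Q⌋₊, ((q : ℝ) + 1) := by
        refine sum_le_sum fun q _ ↦ ?_
        have := (card_filter_le (range (q + 1)) (fun a : ℕ ↦ a.Coprime q))
        rw [card_range] at this
        exact_mod_cast this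
    _ ≤ ∑ _q ∈ Icc 1 ⌊Q⌋₊, (Q + 1) := by
        refine sum_le_sum fun q hq ↦ ?_
        have : (q : ℝ) ≤ ⌊Q⌋₊ := by exact_mod_cast (mem_Icc.mp hq).2
        linarith
    _ = ⌊Q⌋₊ * (Q + 1) := by rw [sum_const, Nat.card_Icc, nsmul_eq_mul]; push_cast; ring
    _ ≤ Q * (Q + 1) := by gcongr
    _ ≤ 2 * Q ^ 2 := by nlinarith

/-- The measure of the major arcs: `vol(𝔐_{Q,P/N}) ≤ 2Q² · 2P/N` for `Q ≥ 1`, `P/N ≥ 0`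
(Matomäki–Radziwiłł–Tao 2019, p. 20: "the set `𝔐_{log^B X, X^{-1} log^{B'} X}` has measure
`O(X^{-1} log^{2B+B'} X)`"). [cite: MatomakiRadziwillTao2019, §4, p. 20 (arXiv)] -/
theorem volume_real_majorArcs_le {N : ℕ} {P Q : ℝ} (hQ : 1 ≤ Q) (hP : 0 ≤ P / N) :
    volume.real (majorArcs N P Q) ≤ 2 * Q ^ 2 * (2 * (P / N)) := by
  rw [majorArcs_eq_biUnion, Measure.real]
  have hle : volume (⋃ i ∈ majorArcIndex Q, majorArc N i.1 (i.2 : ℤ) P) ≤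
      ∑ i ∈ majorArcIndex Q, volume (majorArc N i.1 (i.2 : ℤ) P) :=
    measure_biUnion_finset_le (majorArcIndex Q) (fun i ↦ majorArc N i.1 (i.2 : ℤ) P)
  have hsum : ∑ i ∈ majorArcIndex Q, volume (majorArc N i.1 (i.2 : ℤ) P) ≤
      ∑ _i ∈ majorArcIndex Q, ENNReal.ofReal (2 * (P / N)) :=
    sum_le_sum fun i _ ↦ volume_majorArc_le N i.1 i.2 P
  rw [sum_const, nsmul_eq_mul] at hsum
  have hfin : ((majorArcIndex Q).card : ENNReal) * ENNReal.ofReal (2 * (P / N)) ≠ ⊤ :=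
    ENNReal.mul_ne_top (ENNReal.natCast_ne_top _) ENNReal.ofReal_ne_top
  calc (volume (⋃ i ∈ majorArcIndex Q, majorArc N i.1 (i.2 : ℤ) P)).toReal
      ≤ (((majorArcIndex Q).card : ENNReal) * ENNReal.ofReal (2 * (P / N))).toReal :=
        ENNReal.toReal_mono hfin (hle.trans hsum)
    _ = (majorArcIndex Q).card * (2 * (P / N)) := by
        rw [ENNReal.toReal_mul, ENNReal.toReal_natCast, ENNReal.toReal_ofReal (by positivity)]
    _ ≤ 2 * Q ^ 2 * (2 * (P / N)) := by
        gcongr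
        exact card_majorArcIndex_le hQ

/-- **Decomposition of the major-arc integral** into the sum over the individual (pairwise disjoint,
for `2PQ² < N`) arcs. [cite: VaughanHL1997, §3.1] -/
theorem integral_majorArcs_eq_sum {N : ℕ} {P Q : ℝ} (hQ : 0 ≤ Q) (hN : 2 * P * Q ^ 2 < N)
    {f : ℝ → ℂ} (hf : Continuous f) :
    ∫ α in majorArcs N P Q, f α =
      ∑ q ∈ Icc 1 ⌊Q⌋₊, ∑ a ∈ (range (q + 1)).filter (fun a : ℕ ↦ a.Coprime q),
        ∫ α in majorArc N q (a : ℤ) P, f α := by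
  rw [majorArcs_eq_biUnion, integral_biUnion_finset, majorArcIndex, sum_sigma]
  · intro i _
    exact measurableSet_majorArc N i.1 i.2 P
  · -- pairwise disjointness from `pairwiseDisjoint_majorArc_holds`
    intro i hi j hj hij
    have hdisj := pairwiseDisjoint_majorArc_holds N P Q hN
    have hmem : ∀ k ∈ (majorArcIndex Q : Set (Σ _ : ℕ, ℕ)),
        ((k.1, (k.2 : ℤ)) : ℕ × ℤ) ∈ {x : ℕ × ℤ | 1 ≤ x.1 ∧ (x.1 : ℝ) ≤ Q ∧ 0 ≤ x.2 ∧
          x.2 ≤ x.1 ∧ IsCoprime x.2 (x.1 : ℤ)} := by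
      intro k hk
      simp only [majorArcIndex, coe_sigma, Set.mem_sigma_iff, coe_Icc, Set.mem_Icc, coe_filter,
        mem_range, Set.mem_setOf_eq] at hk
      obtain ⟨⟨hk1, hk2⟩, hk3, hk4⟩ := hk
      show 1 ≤ k.1 ∧ (k.1 : ℝ) ≤ Q ∧ (0 : ℤ) ≤ (k.2 : ℤ) ∧ (k.2 : ℤ) ≤ (k.1 : ℤ) ∧
        IsCoprime (k.2 : ℤ) (k.1 : ℤ)
      refine ⟨hk1, ?_, by positivity, by exact_mod_cast Nat.lt_succ_iff.mp hk3,
        Nat.isCoprime_iff_coprime.mpr hk4⟩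
      exact (Nat.cast_le.mpr hk2).trans (Nat.floor_le hQ)
    have hne : ((i.1, (i.2 : ℤ)) : ℕ × ℤ) ≠ (j.1, (j.2 : ℤ)) := by
      intro heq
      apply hij
      obtain ⟨qi, ai⟩ := i
      obtain ⟨qj, aj⟩ := j
      simp only [Prod.mk.injEq, Nat.cast_inj] at heq
      obtain ⟨rfl, rfl⟩ := heq
      rfl
    have := hdisj (hmem i hi) (hmem j hj) hne
    change Disjoint (majorArc N i.1 (i.2 : ℤ) P) (majorArc N j.1 (j.2 : ℤ) P)
    exact this
  · intro i _
    exact (hf.integrableOn_Icc).mono_set fun α hα ↦ hα.1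

/-! ### Translating an arc integral to `[-δ, δ]` -/

/-- For an interior arc: `∫_{𝔐(q,a)} F = ∫_{-δ}^{δ} F(a/q + β) dβ`. [folklore] -/
theorem integral_majorArc_interior {N q : ℕ} {a : ℤ} {P : ℝ} (hq : 0 < q) (ha0 : 0 < a) (haq : a < q)
    (hP : 0 ≤ P / N) (hδ : P / N ≤ 1 / q) (F : ℝ → ℂ) :
    ∫ α in majorArc N q a P, F α = ∫ β in (-(P / N))..(P / N), F ((a : ℝ) / q + β) := by
  rw [majorArc_eq_Icc hq ha0 haq hδ, integral_Icc_eq_integral_Ioc,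
    ← intervalIntegral.integral_of_le (by linarith), intervalIntegral.integral_comp_add_left,
    ← sub_eq_add_neg]

/-- For the arc at `0`: `∫_{𝔐(q,0)} F = ∫_{0}^{δ} F(β) dβ`. [folklore] -/
theorem integral_majorArc_zero {N q : ℕ} {P : ℝ} (hP : 0 ≤ P / N) (hδ : P / N ≤ 1) (F : ℝ → ℂ) :
    ∫ α in majorArc N q 0 P, F α = ∫ β in (0 : ℝ)..(P / N), F β := by
  rw [majorArc_zero hP hδ, integral_Icc_eq_integral_Ioc, ← intervalIntegral.integral_of_le hP]

/-- For the arc at `1` (`q = a = 1`) and a `1`-periodic `F`: `∫_{𝔐(1,1)} F = ∫_{-δ}^{0} F(β) dβ`.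
[folklore] -/
theorem integral_majorArc_one_one {N : ℕ} {P : ℝ} (hP : 0 ≤ P / N) (hδ : P / N ≤ 1) {F : ℝ → ℂ}
    (hF : Function.Periodic F 1) :
    ∫ α in majorArc N 1 1 P, F α = ∫ β in (-(P / N))..0, F β := by
  rw [majorArc_one_one hP hδ, integral_Icc_eq_integral_Ioc,
    ← intervalIntegral.integral_of_le (by linarith)]
  calc ∫ x in (1 - P / N)..1, F x = ∫ β in (-(P / N))..0, F (β + 1) := by
        rw [intervalIntegral.integral_comp_add_right]
        congr 1 <;> ring
    _ = ∫ β in (-(P / N))..0, F β := intervalIntegral.integral_congr fun β _ ↦ hF β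

/-! ### The integrand and its arc models -/

/-- `primeExpSum N` is continuous in `α`. [folklore] -/
@[fun_prop]
theorem continuous_primeExpSum (N : ℕ) : Continuous (primeExpSum N) := by
  unfold primeExpSum; fun_prop

/-- `primeExpSumDyadic X` is continuous in `α`. [folklore] -/
@[fun_prop]
theorem continuous_primeExpSumDyadic (X : ℕ) : Continuous (primeExpSumDyadic X) := by
  unfold primeExpSumDyadic; fun_prop

/-- The integrand `|S_{Λ1_{(X,2X]}}(α)|² e(αh)` of Prop. 3.3(i). [cite: MatomakiRadziwillTao2019, Prop. 3.3(i), p. 18 (arXiv)] -/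
def hlIntegrand (X : ℕ) (h : ℤ) (α : ℝ) : ℂ :=
  ((‖primeExpSumDyadic X α‖ ^ 2 : ℝ) : ℂ) * (𝐞 (α * h) : ℂ)

/-- Unfolding lemma for `hlIntegrand`. [folklore] -/
theorem hlIntegrand_apply (X : ℕ) (h : ℤ) (α : ℝ) :
    hlIntegrand X h α = ((‖primeExpSumDyadic X α‖ ^ 2 : ℝ) : ℂ) * (𝐞 (α * h) : ℂ) := rfl

/-- The integrand is continuous. [folklore] -/
@[fun_prop]
theorem continuous_hlIntegrand (X : ℕ) (h : ℤ) : Continuous (hlIntegrand X h) := by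
  unfold hlIntegrand; fun_prop

/-- `|integrand| = |S(α)|²`. [folklore] -/
theorem norm_hlIntegrand (X : ℕ) (h : ℤ) (α : ℝ) : ‖hlIntegrand X h α‖ = ‖primeExpSumDyadic X α‖ ^ 2 := by
  rw [hlIntegrand_apply, norm_mul, Circle.norm_coe, mul_one, Complex.norm_real, Real.norm_eq_abs,
    abs_of_nonneg (sq_nonneg _)]

/-- The model of the integrand on the arc `𝔐(q, a)`:
`(μ(q)/φ(q))² e(ah/q) |T_{X,2X}(α - a/q)|² e((α - a/q)h)`. [cite: MatomakiRadziwillTao2019, §4, p. 20 (arXiv)] -/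
def arcModel (X : ℕ) (h : ℤ) (q a : ℕ) (α : ℝ) : ℂ :=
  ((((μ q : ℝ) / (Nat.totient q : ℝ)) ^ 2 : ℝ) : ℂ) * (𝐞 ((a : ℝ) * h / q) : ℂ) *
    expSumIocSqKernel X (2 * X) h (α - a / q)

/-- Unfolding lemma for `arcModel`. [folklore] -/
theorem arcModel_apply (X : ℕ) (h : ℤ) (q a : ℕ) (α : ℝ) :
    arcModel X h q a α = ((((μ q : ℝ) / (Nat.totient q : ℝ)) ^ 2 : ℝ) : ℂ) *
      (𝐞 ((a : ℝ) * h / q) : ℂ) * expSumIocSqKernel X (2 * X) h (α - a / q) := rfl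

/-- The model is continuous. [folklore] -/
@[fun_prop]
theorem continuous_arcModel (X : ℕ) (h : ℤ) (q a : ℕ) : Continuous (arcModel X h q a) := by
  unfold arcModel; fun_prop

/-- The model rewritten with the phase `e(αh)`:
`arcModel = (μ/φ)² |T(α - a/q)|² e(αh)`. [folklore] -/
theorem arcModel_eq (X : ℕ) (h : ℤ) (q a : ℕ) (α : ℝ) :
    arcModel X h q a α = ((((μ q : ℝ) / (Nat.totient q : ℝ)) ^ 2 *
      ‖expSumIoc X (2 * X) (α - a / q)‖ ^ 2 : ℝ) : ℂ) * (𝐞 (α * h) : ℂ) := by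
  rw [arcModel_apply, expSumIocSqKernel_apply, mul_assoc, mul_left_comm (𝐞 ((a : ℝ) * h / q) : ℂ),
    fourierChar_coe_mul, ← mul_assoc, ← Complex.ofReal_mul]
  congr 3
  ring

/-- Integrand minus model on an arc: `(|S(α)|² - (μ/φ)²|T(α - a/q)|²) e(αh)`, of norm
`| |S(α)|² - (μ/φ)²|T(α-a/q)|² |`. [folklore] -/
theorem norm_hlIntegrand_sub_arcModel (X : ℕ) (h : ℤ) (q a : ℕ) (α : ℝ) :
    ‖hlIntegrand X h α - arcModel X h q a α‖ =
      |‖primeExpSumDyadic X α‖ ^ 2 -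
        ((μ q : ℝ) / (Nat.totient q : ℝ)) ^ 2 * ‖expSumIoc X (2 * X) (α - a / q)‖ ^ 2| := by
  rw [hlIntegrand_apply, arcModel_eq, ← sub_mul, norm_mul, Circle.norm_coe, mul_one,
    ← Complex.ofReal_sub, Complex.norm_real, Real.norm_eq_abs]

/-! ### Main term on the arcs around `a/q`, summed over `a` -/

/-- The truncated kernel integral `I_δ = ∫_{-δ}^{δ} |T_{X,2X}(β)|² e(βh) dβ`. [folklore] -/
def kernelIntegral (X : ℕ) (h : ℤ) (δ : ℝ) : ℂ :=
  ∫ β in (-δ)..δ, expSumIocSqKernel X (2 * X) h β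

/-- For `q ≥ 2`, the reduced residues in `range (q+1)` are those in `range q`, all non-zero. [folklore] -/
theorem filter_coprime_range_succ {q : ℕ} (hq : 2 ≤ q) :
    (range (q + 1)).filter (fun a : ℕ ↦ a.Coprime q) = (range q).filter (fun a : ℕ ↦ a.Coprime q) := by
  rw [range_add_one, filter_insert, if_neg]
  rw [Nat.coprime_self]
  omega

/-- **Main term over the arcs at denominator `q`**: for `1 ≤ q`, `0 ≤ δ = P/X ≤ min(1, 1/q)`,
`∑_{a : (a,q)=1} ∫_{𝔐(q,a)} arcModel = g_{|h|}(q) · I_δ` with `g` the Ramanujan-series term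
`μ²(q) c_q(h)/φ(q)²` (for `q = 1` the two half-arcs at `0` and `1` combine by periodicity).
[cite: MatomakiRadziwillTao2019, §4, pp. 20–21 (arXiv)] -/
theorem sum_integral_arcModel {X : ℕ} {P : ℝ} (h : ℤ) {q : ℕ} (hq : 1 ≤ q) (hP : 0 ≤ P / X)
    (hδ1 : P / X ≤ 1) (hδq : P / X ≤ 1 / q) :
    ∑ a ∈ (range (q + 1)).filter (fun a : ℕ ↦ a.Coprime q), ∫ α in majorArc X q (a : ℤ) P, arcModel X h q a α =
      ((goldbachSeriesTerm h.natAbs q : ℝ) : ℂ) * kernelIntegral X h (P / X) := by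
  have hcoef : ∀ q : ℕ, ((((μ q : ℝ) / (Nat.totient q : ℝ)) ^ 2 : ℝ) : ℂ) * ramanujanSum q h =
      ((goldbachSeriesTerm h.natAbs q : ℝ) : ℂ) := by
    intro q
    rw [ramanujanSum_eq_ramanujanDivisorSum, goldbachSeriesTerm_apply]
    push_cast
    ring
  rcases Nat.lt_or_ge q 2 with hq1 | hq2
  · -- `q = 1`: arcs `[0, δ]` and `[1 - δ, 1]`
    obtain rfl : q = 1 := by omega
    have hset : (range (1 + 1)).filter (fun a : ℕ ↦ a.Coprime 1) = {0, 1} := by decide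
    rw [hset, sum_pair (by norm_num), ← hcoef 1, ramanujanSum_one, mul_one]
    have hmodel0 : arcModel X h 1 0 = fun α ↦ expSumIocSqKernel X (2 * X) h α := by
      funext α; simp [arcModel_apply]
    have hmodel1 : arcModel X h 1 1 = fun α ↦ expSumIocSqKernel X (2 * X) h (α - 1) := by
      funext α
      rw [arcModel_apply]
      simp [RamanujanSum.fourierChar_intCast]
    have hper : Function.Periodic (fun α : ℝ ↦ expSumIocSqKernel X (2 * X) h (α - 1)) 1 := by
      intro α; simp only [add_sub_cancel_right]
      have := periodic_expSumIocSqKernel (X : ℤ) (2 * X) h (α - 1)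
      rwa [sub_add_cancel] at this
    rw [hmodel0, hmodel1, Nat.cast_zero, integral_majorArc_zero hP hδ1, Nat.cast_one,
      integral_majorArc_one_one hP hδ1 hper]
    have hshift : ∫ β in (-(P / X))..0, expSumIocSqKernel X (2 * X) h (β - 1) =
        ∫ β in (-(P / X))..0, expSumIocSqKernel X (2 * X) h β := by
      refine intervalIntegral.integral_congr fun β _ ↦ ?_
      have := periodic_expSumIocSqKernel (X : ℤ) (2 * X) h (β - 1)
      rw [sub_add_cancel] at this
      exact this.symm
    rw [hshift, kernelIntegral]
    have hii : ∀ u v : ℝ, IntervalIntegrable (expSumIocSqKernel X (2 * X) h) volume u v :=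
      fun u v ↦ (continuous_expSumIocSqKernel _ _ _).intervalIntegrable _ _
    have h11 : ((((μ 1 : ℝ) / (Nat.totient 1 : ℝ)) ^ 2 : ℝ) : ℂ) = 1 := by
      rw [ArithmeticFunction.moebius_apply_one, Nat.totient_one]; norm_num
    rw [h11, one_mul, add_comm, intervalIntegral.integral_add_adjacent_intervals (hii _ _) (hii _ _)]
  · -- `q ≥ 2`: all arcs are interior
    rw [filter_coprime_range_succ hq2, ← hcoef q, ramanujanSum, mul_sum, sum_mul]
    refine sum_congr rfl fun a ha ↦ ?_
    obtain ⟨haq, hcop⟩ := mem_filter.mp ha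
    rw [mem_range] at haq
    have ha0 : a ≠ 0 := by
      rintro rfl
      rw [Nat.coprime_zero_left] at hcop
      omega
    have hq0 : 0 < q := by omega
    rw [integral_majorArc_interior hq0 (by exact_mod_cast Nat.pos_of_ne_zero ha0)
      (by exact_mod_cast haq) hP hδq]
    have hmodel : ∀ β : ℝ, arcModel X h q a (((a : ℤ) : ℝ) / q + β) =
        ((((μ q : ℝ) / (Nat.totient q : ℝ)) ^ 2 : ℝ) : ℂ) * (𝐞 ((a : ℝ) * h / q) : ℂ) *
          expSumIocSqKernel X (2 * X) h β := by
      intro β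
      rw [arcModel_apply]
      congr 2
      push_cast
      ring
    simp_rw [hmodel, intervalIntegral.integral_const_mul, kernelIntegral]

/-! ### From Prop. 4.1 to the dyadic sum-kernel approximation -/

/-- `|μ(q)/φ(q)| ≤ 1` for every `q`: for `q ≥ 1` this is
`Literature.NumberTheory.Sieve.CircleMethodMajorArcs.norm_moebius_div_totient_le_one` (`CircleMethodMajorArcsProofs.lean`),
and the value at `q = 0` is `0`. [folklore] -/
theorem norm_moebius_div_totient_le (q : ℕ) :
    ‖((μ q : ℝ) / (Nat.totient q : ℝ) : ℂ)‖ ≤ 1 := by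
  rcases Nat.eq_zero_or_pos q with rfl | hq
  · simp
  · exact CircleMethodMajorArcs.norm_moebius_div_totient_le_one hq

/-- `log(2X) ≥ 2` for `X ≥ 4` (as `e² < 8`). [folklore] -/
theorem two_le_log_two_mul {X : ℝ} (hX : 4 ≤ X) : 2 ≤ Real.log (2 * X) := by
  rw [Real.le_log_iff_exp_le (by linarith)]
  have h1 := Real.exp_one_lt_d9
  have : Real.exp 2 = Real.exp 1 ^ 2 := by rw [← Real.exp_nat_mul]; norm_num
  rw [this]
  nlinarith [Real.exp_pos 1]

/-- The dyadic prime exponential sum as a sum over `(X, 2X]`. [folklore] -/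
theorem primeExpSumDyadic_eq_sum (X : ℕ) (α : ℝ) :
    primeExpSumDyadic X α = ∑ n ∈ Ioc X (2 * X), (Λ n : ℂ) * (𝐞 (n * α) : ℂ) := by
  rw [primeExpSumDyadic, primeExpSum, primeExpSum, sub_eq_iff_eq_add,
    ← sum_union (disjoint_left.mpr fun n h1 h2 ↦ by simp at h1 h2; omega)]
  congr 1
  ext n; simp; omega

/-- Trivial bound `|S_{Λ1_{(X,2X]}}(α)| ≤ ψ(2X) ≤ (log 4 + 4)·2X`. [folklore] -/
theorem norm_primeExpSumDyadic_le (X : ℕ) (α : ℝ) :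
    ‖primeExpSumDyadic X α‖ ≤ (Real.log 4 + 4) * (2 * X) := by
  rw [primeExpSumDyadic_eq_sum]
  calc ‖∑ n ∈ Ioc X (2 * X), (Λ n : ℂ) * (𝐞 (n * α) : ℂ)‖
      ≤ ∑ n ∈ Ioc X (2 * X), ‖(Λ n : ℂ) * (𝐞 (n * α) : ℂ)‖ := norm_sum_le _ _
    _ = ∑ n ∈ Ioc X (2 * X), Λ n := by
        refine sum_congr rfl fun n _ ↦ ?_
        rw [norm_mul, Circle.norm_coe, mul_one, Complex.norm_real,
          Real.norm_of_nonneg ArithmeticFunction.vonMangoldt_nonneg]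
    _ ≤ ∑ n ∈ Ioc 0 (2 * X), Λ n :=
        sum_le_sum_of_subset_of_nonneg (fun n hn ↦ by simp at hn ⊢; omega)
          (fun _ _ _ ↦ ArithmeticFunction.vonMangoldt_nonneg)
    _ = Chebyshev.psi (2 * X : ℕ) := by
        rw [Chebyshev.psi, Nat.floor_natCast]
    _ ≤ (Real.log 4 + 4) * (2 * X) := by
        have := Chebyshev.psi_le_const_mul_self (x := ((2 * X : ℕ) : ℝ)) (by positivity)
        push_cast at this ⊢
        exact this

/-- **Prop. 4.1 ⇒ dyadic, sum-kernel form.** Assuming `MatomakiRadziwillTao2019_prop41`: for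
`A', B, B' > 0` there is `C` with
`|S_{Λ1_{(X,2X]}}(a/q + β) - (μ(q)/φ(q)) T_{X,2X}(β)| ≤ C X log^{-A'} X`
for all `X ≥ 4`, `1 ≤ q ≤ log^B X`, `(a,q) = 1`, `|β| ≤ log^{B'} X / X`. This is the "hence also"
display of Matomäki–Radziwiłł–Tao 2019, Prop. 4.1 (dyadic form), with the integral kernel
`∫_X^{2X} e(βx) dx` replaced by the sum `T_{X,2X}(β)` at cost `2π|β|X ≤ 2π log^{B'} X`.
[cite: MatomakiRadziwillTao2019, Prop. 4.1, p. 20 (arXiv)] -/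
theorem primeExpSumDyadic_approx (h41 : MatomakiRadziwillTao2019_prop41) {A' B B' : ℝ}
    (hA' : 0 < A') (hB : 0 < B) (hB' : 0 < B') :
    ∃ C : ℝ, ∀ X : ℕ, 4 ≤ X → ∀ q : ℕ, 1 ≤ q → (q : ℝ) ≤ Real.log X ^ B →
      ∀ a : ℤ, Int.gcd a q = 1 → ∀ β : ℝ, |β| ≤ Real.log X ^ B' / X →
        ‖primeExpSumDyadic X (a / q + β) -
            ((μ q : ℝ) / (Nat.totient q : ℝ) : ℂ) * expSumIoc X (2 * X) β‖ ≤
          C * X * Real.log X ^ (-A') := by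
  obtain ⟨C₁, hC₁⟩ := h41 A' B (B' + 1) hA' hB (by linarith)
  obtain ⟨C₂, hC₂⟩ := h41 A' B B' hA' hB hB'
  obtain ⟨K, hK, hKle⟩ := exists_log_rpow_le_rpow (k := A' + B') (by linarith) one_pos
  refine ⟨2 * |C₁| + |C₂| + 2 * Real.pi * K, fun X hX q hq hqB a ha β hβ ↦ ?_⟩
  -- basic quantities
  have hX0 : (0 : ℝ) < X := by exact_mod_cast (by omega : 0 < X)
  have hX1 : (1 : ℝ) ≤ X := by exact_mod_cast (by omega : 1 ≤ X)
  have hX4 : (4 : ℝ) ≤ X := by exact_mod_cast hX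
  set L := Real.log X with hL
  have hL0 : 0 < L := Real.log_pos (by linarith)
  have hL2 : L ≤ Real.log ((2 * X : ℕ) : ℝ) := by
    push_cast; exact Real.log_le_log hX0 (by linarith)
  have hlog2X : 2 ≤ Real.log ((2 * X : ℕ) : ℝ) := by push_cast; exact two_le_log_two_mul hX4
  -- Prop 4.1 at `2X` with exponent `B' + 1`
  have h2X : ‖primeExpSum (2 * X) (a / q + β) - ((μ q : ℝ) / (Nat.totient q : ℝ) : ℂ) *
      ∫ x in (1 : ℝ)..((2 * X : ℕ) : ℝ), (𝐞 (β * x) : ℂ)‖ ≤ |C₁| * (2 * X) * L ^ (-A') := by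
    have hq' : (q : ℝ) ≤ Real.log ((2 * X : ℕ) : ℝ) ^ B :=
      hqB.trans (Real.rpow_le_rpow hL0.le hL2 hB.le)
    have hβ' : |β| ≤ Real.log ((2 * X : ℕ) : ℝ) ^ (B' + 1) / ((2 * X : ℕ) : ℝ) := by
      refine hβ.trans ?_
      set M := Real.log ((2 * X : ℕ) : ℝ) with hM
      have hM0 : 0 < M := by linarith
      have hM1 : L ^ B' ≤ M ^ B' := Real.rpow_le_rpow hL0.le hL2 hB'.le
      have hM2 : M ^ (B' + 1) = M ^ B' * M := by rw [Real.rpow_add hM0, Real.rpow_one]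
      have h2X : ((2 * X : ℕ) : ℝ) = 2 * X := by push_cast; ring
      rw [div_le_div_iff₀ hX0 (by rw [h2X]; positivity), hM2, h2X]
      have hLB0 : 0 ≤ L ^ B' := by positivity
      have : L ^ B' * 2 ≤ M ^ B' * M := mul_le_mul hM1 hlog2X (by norm_num) (by positivity)
      nlinarith
    have := hC₁ (2 * X) (by omega) q hq hq' a ha β hβ'
    refine this.trans ?_
    have hneg : Real.log ((2 * X : ℕ) : ℝ) ^ (-A') ≤ L ^ (-A') :=
      Real.rpow_le_rpow_of_nonpos hL0 hL2 (by linarith)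
    push_cast at hneg hlog2X ⊢
    have hM0 : 0 ≤ Real.log (2 * (X : ℝ)) ^ (-A') :=
      Real.rpow_nonneg (by linarith) _
    calc C₁ * (2 * (X : ℝ)) * Real.log (2 * (X : ℝ)) ^ (-A')
        ≤ |C₁| * (2 * (X : ℝ)) * Real.log (2 * (X : ℝ)) ^ (-A') :=
          mul_le_mul_of_nonneg_right (mul_le_mul_of_nonneg_right (le_abs_self _) (by positivity)) hM0
      _ ≤ |C₁| * (2 * X) * L ^ (-A') := mul_le_mul_of_nonneg_left hneg (by positivity)
  -- Prop 4.1 at `X`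
  have h1X : ‖primeExpSum X (a / q + β) - ((μ q : ℝ) / (Nat.totient q : ℝ) : ℂ) *
      ∫ x in (1 : ℝ)..(X : ℝ), (𝐞 (β * x) : ℂ)‖ ≤ |C₂| * X * L ^ (-A') := by
    have := hC₂ X (by omega) q hq hqB a ha β hβ
    refine this.trans ?_
    have hLA : 0 ≤ L ^ (-A') := Real.rpow_nonneg hL0.le _
    exact mul_le_mul_of_nonneg_right (mul_le_mul_of_nonneg_right (le_abs_self _) hX0.le) hLA
  -- the kernel: `∫_1^{2X} - ∫_1^X = ∫_X^{2X}` and `|∫_X^{2X} e(βx) dx - T(β)| ≤ 2π|β|X`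
  have hcont : Continuous fun x : ℝ ↦ (𝐞 (β * x) : ℂ) := by fun_prop
  have hsplit : (∫ x in (1 : ℝ)..((2 * X : ℕ) : ℝ), (𝐞 (β * x) : ℂ)) -
      ∫ x in (1 : ℝ)..(X : ℝ), (𝐞 (β * x) : ℂ) = ∫ x in (X : ℝ)..((2 * X : ℕ) : ℝ), (𝐞 (β * x) : ℂ) :=
    intervalIntegral.integral_interval_sub_left (hcont.intervalIntegrable _ _)
      (hcont.intervalIntegrable _ _)
  have hkernel : ‖(∫ x in (X : ℝ)..((2 * X : ℕ) : ℝ), (𝐞 (β * x) : ℂ)) - expSumIoc X (2 * X) β‖ ≤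
      2 * Real.pi * K * X * L ^ (-A') := by
    have := norm_expSumIoc_sub_integral_le (a := (X : ℤ)) (b := 2 * (X : ℤ)) (by omega) β
    rw [norm_sub_rev]
    push_cast at this ⊢
    refine this.trans ?_
    -- `2π|β|(2X - X) ≤ 2π L^{B'} ≤ 2π K X L^{-A'}`
    have hβX : |β| * (2 * (X : ℝ) - X) ≤ L ^ B' := by
      rw [show 2 * (X : ℝ) - X = X by ring]
      calc |β| * X ≤ L ^ B' / X * X := by gcongr
        _ = L ^ B' := div_mul_cancel₀ _ hX0.ne'
    have hLB : L ^ B' ≤ K * X * L ^ (-A') := by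
      have h1 : L ^ (A' + B') ≤ K * (X : ℝ) ^ (1 : ℝ) := hKle X hX1
      rw [Real.rpow_one] at h1
      calc L ^ B' = L ^ (A' + B') * L ^ (-A') := by
            rw [← Real.rpow_add hL0]; ring_nf
        _ ≤ K * X * L ^ (-A') := by gcongr
    calc 2 * Real.pi * |β| * (2 * (X : ℝ) - X) = 2 * Real.pi * (|β| * (2 * (X : ℝ) - X)) := by ring
      _ ≤ 2 * Real.pi * (K * X * L ^ (-A')) :=
          mul_le_mul_of_nonneg_left (hβX.trans hLB) (by positivity)
      _ = 2 * Real.pi * K * X * L ^ (-A') := by ring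
  -- assemble
  have hμ := norm_moebius_div_totient_le q
  set m : ℂ := ((μ q : ℝ) / (Nat.totient q : ℝ) : ℂ) with hm
  set I2 := ∫ x in (1 : ℝ)..((2 * X : ℕ) : ℝ), (𝐞 (β * x) : ℂ)
  set I1 := ∫ x in (1 : ℝ)..(X : ℝ), (𝐞 (β * x) : ℂ)
  set IX := ∫ x in (X : ℝ)..((2 * X : ℕ) : ℝ), (𝐞 (β * x) : ℂ)
  have hdecomp : primeExpSumDyadic X (a / q + β) - m * expSumIoc X (2 * X) β =
      (primeExpSum (2 * X) (a / q + β) - m * I2) - (primeExpSum X (a / q + β) - m * I1) +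
        m * (IX - expSumIoc X (2 * X) β) := by
    rw [primeExpSumDyadic, ← hsplit]; ring
  rw [hdecomp]
  calc ‖(primeExpSum (2 * X) (a / q + β) - m * I2) - (primeExpSum X (a / q + β) - m * I1) +
        m * (IX - expSumIoc X (2 * X) β)‖
      ≤ ‖primeExpSum (2 * X) (a / q + β) - m * I2‖ + ‖primeExpSum X (a / q + β) - m * I1‖ +
        ‖m‖ * ‖IX - expSumIoc X (2 * X) β‖ := by
        refine (norm_add_le _ _).trans (add_le_add (norm_sub_le _ _) ?_)
        rw [norm_mul]
    _ ≤ |C₁| * (2 * X) * L ^ (-A') + |C₂| * X * L ^ (-A') + 1 * (2 * Real.pi * K * X * L ^ (-A')) := by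
        gcongr
    _ = (2 * |C₁| + |C₂| + 2 * Real.pi * K) * X * L ^ (-A') := by ring

/-- **Pointwise major-arc approximation of `|S|²`.** Under Prop. 4.1: for `A', B, B' > 0` there is
`C` with `| |S_{Λ1_{(X,2X]}}(a/q+β)|² - (μ(q)²/φ(q)²)|T_{X,2X}(β)|² | ≤ C X² log^{-A'} X` on every
major arc (`X ≥ 4`), as in the first display of the proof of Prop. 3.3(i) in
Matomäki–Radziwiłł–Tao 2019 (p. 20: "From Proposition 4.1 and the crude bound
`S_{Λ1_{(X,2X]}}(α) ≪ X` …"). [cite: MatomakiRadziwillTao2019, §4, p. 20 (arXiv)] -/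
theorem normSq_primeExpSumDyadic_approx (h41 : MatomakiRadziwillTao2019_prop41) {A' B B' : ℝ}
    (hA' : 0 < A') (hB : 0 < B) (hB' : 0 < B') :
    ∃ C : ℝ, ∀ X : ℕ, 4 ≤ X → ∀ q : ℕ, 1 ≤ q → (q : ℝ) ≤ Real.log X ^ B →
      ∀ a : ℤ, Int.gcd a q = 1 → ∀ β : ℝ, |β| ≤ Real.log X ^ B' / X →
        |‖primeExpSumDyadic X (a / q + β)‖ ^ 2 -
            ((μ q : ℝ) / (Nat.totient q : ℝ)) ^ 2 * ‖expSumIoc X (2 * X) β‖ ^ 2| ≤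
          C * X ^ 2 * Real.log X ^ (-A') := by
  obtain ⟨C, hC⟩ := primeExpSumDyadic_approx h41 hA' hB hB'
  refine ⟨C * (2 * (Real.log 4 + 4) + 1), fun X hX q hq hqB a ha β hβ ↦ ?_⟩
  have h := hC X hX q hq hqB a ha β hβ
  set S := primeExpSumDyadic X (a / q + β)
  set m : ℂ := ((μ q : ℝ) / (Nat.totient q : ℝ) : ℂ)
  set T := expSumIoc X (2 * X) β
  have hX0 : (0 : ℝ) ≤ X := by positivity
  have hm : ‖m‖ ≤ 1 := norm_moebius_div_totient_le q
  have hT : ‖T‖ ≤ X := by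
    have := norm_expSumIoc_le_card (a := (X : ℤ)) (b := 2 * (X : ℤ)) (by omega) β
    push_cast at this
    linarith
  have hS : ‖S‖ ≤ (Real.log 4 + 4) * (2 * X) := norm_primeExpSumDyadic_le X _
  have hmT : ‖m * T‖ ≤ X := by
    rw [norm_mul]
    calc ‖m‖ * ‖T‖ ≤ 1 * X := by gcongr
      _ = X := one_mul _
  have hsq : ((μ q : ℝ) / (Nat.totient q : ℝ)) ^ 2 * ‖T‖ ^ 2 = ‖m * T‖ ^ 2 := by
    rw [norm_mul, mul_pow, norm_div, Complex.norm_real, Complex.norm_real, Real.norm_eq_abs,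
      Real.norm_eq_abs, ← abs_div, sq_abs]
  rw [hsq, sq_sub_sq, abs_mul]
  have hC0 : 0 ≤ C * X * Real.log X ^ (-A') := le_trans (norm_nonneg _) h
  calc |‖S‖ + ‖m * T‖| * |‖S‖ - ‖m * T‖|
      ≤ ((Real.log 4 + 4) * (2 * X) + X) * (C * X * Real.log X ^ (-A')) := by
        refine mul_le_mul ?_ ((abs_norm_sub_norm_le _ _).trans h) (abs_nonneg _) (by positivity)
        rw [abs_of_nonneg (by positivity)]
        exact add_le_add hS hmT
    _ = C * (2 * (Real.log 4 + 4) + 1) * X ^ 2 * Real.log X ^ (-A') := by ring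

/-! ### Error of the arc models, summed over all arcs -/

/-- `volume.real` of a major arc is at most `2P/N`. [folklore] -/
theorem volume_real_majorArc_le (N q : ℕ) (a : ℤ) {P : ℝ} (hP : 0 ≤ P / N) :
    volume.real (majorArc N q a P) ≤ 2 * (P / N) := by
  rw [Measure.real]
  calc (volume (majorArc N q a P)).toReal ≤ (ENNReal.ofReal (2 * (P / N))).toReal :=
        ENNReal.toReal_mono ENNReal.ofReal_ne_top (volume_majorArc_le N q a P)
    _ = 2 * (P / N) := ENNReal.toReal_ofReal (by positivity)

/-- **Major arcs = main term + error** (Matomäki–Radziwiłł–Tao 2019, proof of Prop. 3.3(i), first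
reduction, p. 20): under Prop. 4.1, for `A', B, B' > 0` there is `C` such that for `X ≥ 4` with
`Q = log^B X ≥ 1`, `P = log^{B'} X`, `2PQ² < X`, `P/X ≤ 1/Q`, and every `h`,
`|∫_𝔐 |S|² e(αh) dα - (∑_{q ≤ Q} μ²(q)c_q(h)/φ²(q)) · I_{P/X}(h)| ≤ C X² log^{-A'} X · Q² · P/X`.
[cite: MatomakiRadziwillTao2019, §4, p. 20 (arXiv)] -/
theorem integral_majorArcs_hlIntegrand_approx (h41 : MatomakiRadziwillTao2019_prop41) {A' B B' : ℝ}
    (hA' : 0 < A') (hB : 0 < B) (hB' : 0 < B') :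
    ∃ C : ℝ, 0 ≤ C ∧ ∀ X : ℕ, 4 ≤ X → 1 ≤ Real.log X ^ B →
      2 * Real.log X ^ B' * (Real.log X ^ B) ^ 2 < X →
      Real.log X ^ B' / X ≤ 1 / Real.log X ^ B → ∀ h : ℤ,
        ‖(∫ α in majorArcs X (Real.log X ^ B') (Real.log X ^ B), hlIntegrand X h α) -
            (∑ q ∈ Icc 1 ⌊Real.log X ^ B⌋₊, ((goldbachSeriesTerm h.natAbs q : ℝ) : ℂ)) *
              kernelIntegral X h (Real.log X ^ B' / X)‖ ≤
          C * X ^ 2 * Real.log X ^ (-A') * ((Real.log X ^ B) ^ 2 * (Real.log X ^ B' / X)) := by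
  obtain ⟨C₃, hC₃⟩ := normSq_primeExpSumDyadic_approx h41 hA' hB hB'
  refine ⟨4 * |C₃|, by positivity, fun X hX hQ1 hPQ hδQ h ↦ ?_⟩
  set L := Real.log X with hL
  set Q := L ^ B with hQ
  set P := L ^ B' with hP
  set δ := P / X with hδ
  have hX0 : (0 : ℝ) < X := by exact_mod_cast (by omega : 0 < X)
  have hL0 : 0 < L := Real.log_pos (by exact_mod_cast (by omega : 1 < X))
  have hQ0 : 0 ≤ Q := by positivity
  have hP0 : 0 ≤ P := by positivity
  have hδ0 : 0 ≤ δ := by positivity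
  have hδ1 : δ ≤ 1 := hδQ.trans (by rw [div_le_one (by linarith)]; exact hQ1)
  -- decompose the integral over the arcs
  rw [integral_majorArcs_eq_sum hQ0 hPQ (continuous_hlIntegrand X h)]
  -- main term arc by arc
  have hmain : ∑ q ∈ Icc 1 ⌊Q⌋₊, ∑ a ∈ (range (q + 1)).filter (fun a : ℕ ↦ a.Coprime q),
      ∫ α in majorArc X q (a : ℤ) P, arcModel X h q a α =
      (∑ q ∈ Icc 1 ⌊Q⌋₊, ((goldbachSeriesTerm h.natAbs q : ℝ) : ℂ)) * kernelIntegral X h δ := by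
    rw [sum_mul]
    refine sum_congr rfl fun q hq ↦ ?_
    obtain ⟨hq1, hqQ⟩ := mem_Icc.mp hq
    have hqQ' : (q : ℝ) ≤ Q := (Nat.cast_le.mpr hqQ).trans (Nat.floor_le hQ0)
    have hδq : δ ≤ 1 / q :=
      hδQ.trans (one_div_le_one_div_of_le (by exact_mod_cast hq1) hqQ')
    exact sum_integral_arcModel h hq1 hδ0 hδ1 hδq
  -- error arc by arc
  have herr : ∀ q ∈ Icc 1 ⌊Q⌋₊, ∀ a ∈ (range (q + 1)).filter (fun a : ℕ ↦ a.Coprime q),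
      ‖(∫ α in majorArc X q (a : ℤ) P, hlIntegrand X h α) -
          ∫ α in majorArc X q (a : ℤ) P, arcModel X h q a α‖ ≤
        |C₃| * X ^ 2 * L ^ (-A') * (2 * δ) := by
    intro q hq a ha
    obtain ⟨hq1, hqQ⟩ := mem_Icc.mp hq
    have hqQ' : (q : ℝ) ≤ Q := (Nat.cast_le.mpr hqQ).trans (Nat.floor_le hQ0)
    have hcop : Int.gcd (a : ℤ) q = 1 := by
      rw [Int.gcd_natCast_natCast]; exact (mem_filter.mp ha).2
    rw [← integral_sub ((continuous_hlIntegrand X h).integrableOn_Icc.mono_set fun α hα ↦ hα.1)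
      ((continuous_arcModel X h q a).integrableOn_Icc.mono_set fun α hα ↦ hα.1)]
    have hvol : volume (majorArc X q (a : ℤ) P) < ⊤ :=
      (volume_majorArc_le X q a P).trans_lt ENNReal.ofReal_lt_top
    refine (norm_setIntegral_le_of_norm_le_const (C := |C₃| * X ^ 2 * L ^ (-A')) hvol
      fun α hα ↦ ?_).trans ?_
    · rw [norm_hlIntegrand_sub_arcModel]
      have hβ : |α - (a : ℝ) / q| ≤ L ^ B' / X := by
        have := hα.2; push_cast at this; exact this
      have key := hC₃ X hX q hq1 hqQ' a hcop (α - (a : ℝ) / q) hβ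
      have hα' : ((a : ℤ) : ℝ) / q + (α - (a : ℝ) / q) = α := by push_cast; ring
      rw [hα'] at key
      refine key.trans ?_
      have : 0 ≤ L ^ (-A') := Real.rpow_nonneg hL0.le _
      exact mul_le_mul_of_nonneg_right (mul_le_mul_of_nonneg_right (le_abs_self _) (by positivity)) this
    · have : 0 ≤ |C₃| * (X : ℝ) ^ 2 * L ^ (-A') := by
        have : 0 ≤ L ^ (-A') := Real.rpow_nonneg hL0.le _
        positivity
      exact mul_le_mul_of_nonneg_left (volume_real_majorArc_le X q a hδ0) this
  -- sum the errors
  rw [← hmain, ← sum_sub_distrib]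
  simp_rw [← sum_sub_distrib]
  calc ‖∑ q ∈ Icc 1 ⌊Q⌋₊, ∑ a ∈ (range (q + 1)).filter (fun a : ℕ ↦ a.Coprime q),
        ((∫ α in majorArc X q (a : ℤ) P, hlIntegrand X h α) -
          ∫ α in majorArc X q (a : ℤ) P, arcModel X h q a α)‖
      ≤ ∑ q ∈ Icc 1 ⌊Q⌋₊, ∑ a ∈ (range (q + 1)).filter (fun a : ℕ ↦ a.Coprime q),
          ‖(∫ α in majorArc X q (a : ℤ) P, hlIntegrand X h α) -
            ∫ α in majorArc X q (a : ℤ) P, arcModel X h q a α‖ :=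
        (norm_sum_le _ _).trans (sum_le_sum fun q _ ↦ norm_sum_le _ _)
    _ ≤ ∑ q ∈ Icc 1 ⌊Q⌋₊, ∑ _a ∈ (range (q + 1)).filter (fun a : ℕ ↦ a.Coprime q),
          |C₃| * X ^ 2 * L ^ (-A') * (2 * δ) :=
        sum_le_sum fun q hq ↦ sum_le_sum fun a ha ↦ herr q hq a ha
    _ = (majorArcIndex Q).card * (|C₃| * X ^ 2 * L ^ (-A') * (2 * δ)) := by
        rw [majorArcIndex, card_sigma, Nat.cast_sum, sum_mul]
        refine sum_congr rfl fun q _ ↦ ?_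
        rw [sum_const, nsmul_eq_mul]
    _ ≤ (2 * Q ^ 2) * (|C₃| * X ^ 2 * L ^ (-A') * (2 * δ)) := by
        have : 0 ≤ L ^ (-A') := Real.rpow_nonneg hL0.le _
        exact mul_le_mul_of_nonneg_right (card_majorArcIndex_le hQ1) (by positivity)
    _ = 4 * |C₃| * X ^ 2 * L ^ (-A') * (Q ^ 2 * δ) := by ring

/-! ### Crude bound, valid for every `X` -/

/-- `vol(𝔐) ≤ 1` since `𝔐 ⊆ [0, 1]`. [folklore] -/
theorem volume_majorArcs_le_one (N : ℕ) (P Q : ℝ) : volume (majorArcs N P Q) ≤ 1 := by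
  calc volume (majorArcs N P Q) ≤ volume (Set.Icc (0 : ℝ) 1) := measure_mono (majorArcs_subset_Icc N P Q)
    _ = 1 := by rw [Real.volume_Icc]; norm_num

/-- `|𝔖(h)| ≤ K₀ d(h)²` for `h ≠ 0` (from the Ramanujan-series representation). [folklore] -/
theorem abs_goldbachSingularSeries_le {n : ℕ} (hn : n ≠ 0) :
    |goldbachSingularSeries n| ≤ goldbachWeightConst * (n.divisors.card : ℝ) ^ 2 := by
  rw [← (hasSum_goldbachSeriesTerm hn).tsum_eq]
  have hs := summable_norm_goldbachSeriesTerm hn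
  calc |∑' q, goldbachSeriesTerm n q| = ‖∑' q, goldbachSeriesTerm n q‖ := (Real.norm_eq_abs _).symm
    _ ≤ ∑' q, ‖goldbachSeriesTerm n q‖ := norm_tsum_le_tsum_norm hs
    _ ≤ ∑' q, goldbachWeight n q :=
        hs.tsum_le_tsum (fun q ↦ (Real.norm_eq_abs _).le.trans
          (abs_goldbachSeriesTerm_le_goldbachWeight n q)) (summable_goldbachWeight hn).1
    _ ≤ _ := tsum_goldbachWeight_le hn

/-- **Crude bound**: `|∫_𝔐 |S|² e(αh) dα - 𝔖(|h|) X| ≤ K d(h)² X²` for all `X ≥ 1`, `h ≠ 0` and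
any arcs `𝔐 ⊆ [0,1]` (trivial bound `|S| ≪ X` and `|𝔖(h)| ≪ d(h)²`). [folklore] -/
theorem norm_integral_majorArcs_sub_le_crude :
    ∃ K : ℝ, 0 ≤ K ∧ ∀ X : ℕ, 1 ≤ X → ∀ P Q : ℝ, ∀ h : ℤ, h ≠ 0 →
      ‖(∫ α in majorArcs X P Q, hlIntegrand X h α) - (goldbachSingularSeries h.natAbs * X : ℂ)‖ ≤
        K * ((Nat.divisors h.natAbs).card : ℝ) ^ 2 * X ^ 2 := by
  set c₀ := Real.log 4 + 4 with hc₀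
  have hc₀0 : 0 ≤ c₀ := by positivity
  refine ⟨(2 * c₀) ^ 2 + goldbachWeightConst, add_nonneg (sq_nonneg _) (Real.exp_pos _).le,
    fun X hX P Q h hh ↦ ?_⟩
  have hn : h.natAbs ≠ 0 := Int.natAbs_ne_zero.mpr hh
  have hX1 : (1 : ℝ) ≤ X := by exact_mod_cast hX
  have hd1 : (1 : ℝ) ≤ ((Nat.divisors h.natAbs).card : ℝ) := by
    exact_mod_cast Finset.card_pos.mpr ⟨1, Nat.one_mem_divisors.mpr hn⟩
  have hint : ‖∫ α in majorArcs X P Q, hlIntegrand X h α‖ ≤ (2 * c₀) ^ 2 * X ^ 2 := by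
    have hvol : volume (majorArcs X P Q) < ⊤ := (volume_majorArcs_le_one X P Q).trans_lt ENNReal.one_lt_top
    refine (norm_setIntegral_le_of_norm_le_const (C := (2 * c₀) ^ 2 * X ^ 2) hvol
      fun α _ ↦ ?_).trans ?_
    · rw [norm_hlIntegrand]
      calc ‖primeExpSumDyadic X α‖ ^ 2 ≤ (c₀ * (2 * X)) ^ 2 := by
            gcongr
            exact norm_primeExpSumDyadic_le X α
        _ = (2 * c₀) ^ 2 * X ^ 2 := by ring
    · have hreal : volume.real (majorArcs X P Q) ≤ 1 := by
        rw [Measure.real]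
        calc (volume (majorArcs X P Q)).toReal ≤ (1 : ENNReal).toReal :=
              ENNReal.toReal_mono ENNReal.one_ne_top (volume_majorArcs_le_one X P Q)
          _ = 1 := by simp
      calc (2 * c₀) ^ 2 * (X : ℝ) ^ 2 * volume.real (majorArcs X P Q) ≤ (2 * c₀) ^ 2 * X ^ 2 * 1 := by
            gcongr
        _ = (2 * c₀) ^ 2 * X ^ 2 := mul_one _
  have hSS : ‖(goldbachSingularSeries h.natAbs * X : ℂ)‖ ≤
      goldbachWeightConst * ((Nat.divisors h.natAbs).card : ℝ) ^ 2 * X := by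
    rw [norm_mul, Complex.norm_real, Complex.norm_natCast, Real.norm_eq_abs]
    gcongr
    exact abs_goldbachSingularSeries_le hn
  have hK0 : 0 ≤ goldbachWeightConst := (Real.exp_pos _).le
  calc ‖(∫ α in majorArcs X P Q, hlIntegrand X h α) - (goldbachSingularSeries h.natAbs * X : ℂ)‖
      ≤ (2 * c₀) ^ 2 * X ^ 2 + goldbachWeightConst * ((Nat.divisors h.natAbs).card : ℝ) ^ 2 * X :=
        (norm_sub_le _ _).trans (add_le_add hint hSS)
    _ ≤ (2 * c₀) ^ 2 * (((Nat.divisors h.natAbs).card : ℝ) ^ 2 * X ^ 2) +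
          goldbachWeightConst * (((Nat.divisors h.natAbs).card : ℝ) ^ 2 * X ^ 2) := by
        have h1 : (X : ℝ) ^ 2 ≤ ((Nat.divisors h.natAbs).card : ℝ) ^ 2 * X ^ 2 := by
          have : (1 : ℝ) ≤ ((Nat.divisors h.natAbs).card : ℝ) ^ 2 := by nlinarith
          nlinarith
        have h2 : ((Nat.divisors h.natAbs).card : ℝ) ^ 2 * X ≤ ((Nat.divisors h.natAbs).card : ℝ) ^ 2 * X ^ 2 := by
          have : (X : ℝ) ≤ X ^ 2 := by nlinarith
          gcongr
        nlinarith [mul_le_mul_of_nonneg_left h2 hK0]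
    _ = ((2 * c₀) ^ 2 + goldbachWeightConst) * ((Nat.divisors h.natAbs).card : ℝ) ^ 2 * X ^ 2 := by ring

/-! ### The estimate for large `X` -/

/-- `1 < log 4` (as `e < 4`); private copy of `Literature.NumberTheory.LFunctions.one_lt_log_four`
(`Literature/NumberTheory/LFunctions/RodgersTaoEnergyProofs.lean`, also
`ClassicalZeroFreeRegion.lean`), whose import closures are foreign to this file. [folklore] -/
private theorem one_lt_log_four : 1 < Real.log 4 := by
  rw [Real.lt_log_iff_exp_lt (by norm_num)]
  have := Real.exp_one_lt_d9
  norm_num at this ⊢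
  linarith

/-- **Prop. 3.3(i) for large `X`** (the heart of the proof of Matomäki–Radziwiłł–Tao 2019,
Prop. 3.3(i), pp. 20–21, assuming Prop. 4.1): there are `X₀` and `C` with
`|∫_𝔐 |S|² e(αh) dα - 𝔖(h) X| ≤ C d(h)² X log^{-A} X` for all `X ≥ X₀`, `0 < |h| ≤ X^{1-ε}`.
[cite: MatomakiRadziwillTao2019, Prop. 3.3(i) proof, pp. 20–21 (arXiv)] -/
theorem prop33i_large (h41 : MatomakiRadziwillTao2019_prop41) {A ε B B' : ℝ} (hA : 0 < A)
    (hε : 0 < ε) (hAB : 2 * A ≤ B) (hBB : 2 * B + A ≤ B') :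
    ∃ X₀ C : ℝ, 0 ≤ C ∧ ∀ X : ℕ, X₀ ≤ X → ∀ h : ℤ, h ≠ 0 → (|h| : ℝ) ≤ (X : ℝ) ^ (1 - ε) →
      ‖(∫ α in majorArcs X (Real.log X ^ B') (Real.log X ^ B), hlIntegrand X h α) -
          (goldbachSingularSeries h.natAbs * X : ℂ)‖ ≤
        C * ((Nat.divisors h.natAbs).card : ℝ) ^ 2 * X * Real.log X ^ (-A) := by
  have hB : 0 < B := by linarith
  have hB' : 0 < B' := by linarith
  obtain ⟨C₃, hC₃0, hC₃⟩ :=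
    integral_majorArcs_hlIntegrand_approx h41 (by linarith : 0 < A + 2 * B + B') hB hB'
  obtain ⟨x₁, hx₁1, hx₁⟩ :=
    exists_log_rpow_le_mul (k := B' + 2 * B) (c := 1 / 4) (by linarith) (by norm_num)
  obtain ⟨Kε, hKε0, hKε⟩ := exists_log_rpow_le_rpow (k := A) hA hε
  set K₀ := goldbachWeightConst with hK₀
  have hK₀0 : 0 ≤ K₀ := (Real.exp_pos _).le
  refine ⟨max 4 x₁, C₃ + K₀ * (3 / 2 + Kε), by positivity, fun X hX h hh hhX ↦ ?_⟩
  -- basic quantities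
  have hX4 : (4 : ℝ) ≤ X := (le_max_left _ _).trans hX
  have hXx₁ : x₁ ≤ X := (le_max_right _ _).trans hX
  have hX4' : 4 ≤ X := by exact_mod_cast hX4
  have hX0 : (0 : ℝ) < X := by linarith
  have hX1 : (1 : ℝ) ≤ X := by linarith
  set L := Real.log X with hL
  have hL1 : 1 ≤ L := by
    have := Real.log_le_log (by norm_num) hX4
    linarith [one_lt_log_four]
  have hL0 : 0 < L := by linarith
  have hmono : ∀ s t : ℝ, s ≤ t → L ^ s ≤ L ^ t :=
    fun s t hst ↦ Real.rpow_le_rpow_of_exponent_le hL1 hst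
  have hLA0 : 0 ≤ L ^ (-A) := Real.rpow_nonneg hL0.le _
  set Q := L ^ B with hQ
  set P := L ^ B' with hP
  set δ := P / X with hδ
  have hQ1 : 1 ≤ Q := Real.one_le_rpow hL1 hB.le
  have hQ0 : 0 < Q := by linarith
  have hP0 : 0 < P := Real.rpow_pos_of_pos hL0 _
  have hδ0 : 0 < δ := div_pos hP0 hX0
  -- the large-`X` conditions
  have hbig : L ^ (B' + 2 * B) ≤ X / 4 := by
    have := hx₁ X hXx₁; linarith
  have hPQ2 : P * Q ^ 2 = L ^ (B' + 2 * B) := by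
    rw [hP, hQ, ← Real.rpow_natCast, ← Real.rpow_mul hL0.le, ← Real.rpow_add hL0]
    congr 1
    push_cast
    ring
  have hcond1 : 2 * P * Q ^ 2 < X := by
    rw [mul_assoc, hPQ2]; linarith
  have hcond2 : P / X ≤ 1 / Q := by
    rw [div_le_div_iff₀ hX0 hQ0, one_mul]
    calc P * Q = L ^ (B' + B) := by rw [hP, hQ, ← Real.rpow_add hL0]
      _ ≤ L ^ (B' + 2 * B) := hmono _ _ (by linarith)
      _ ≤ X := by linarith
  have hδhalf : δ ≤ 1 / 2 := by
    rw [hδ, div_le_div_iff₀ hX0 (by norm_num), one_mul]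
    have : P ≤ L ^ (B' + 2 * B) := by
      rw [hP]; exact hmono _ _ (by linarith)
    linarith
  -- Step 1: arcs = main + O(X L^{-A})
  have h1 := hC₃ X hX4' hQ1 hcond1 hcond2 h
  have hLL : L ^ (-(A + 2 * B + B')) * L ^ (B' + 2 * B) = L ^ (-A) := by
    rw [← Real.rpow_add hL0]; congr 1; ring
  have hE1 : C₃ * (X : ℝ) ^ 2 * L ^ (-(A + 2 * B + B')) * (Q ^ 2 * (P / X)) = C₃ * X * L ^ (-A) := by
    calc C₃ * (X : ℝ) ^ 2 * L ^ (-(A + 2 * B + B')) * (Q ^ 2 * (P / X))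
        = C₃ * ((X : ℝ) ^ 2 / X) * (L ^ (-(A + 2 * B + B')) * (P * Q ^ 2)) := by ring
      _ = C₃ * X * L ^ (-A) := by
          rw [hPQ2, hLL, sq, mul_div_assoc, div_self hX0.ne', mul_one]
  rw [hE1] at h1
  -- Step 2: the kernel integral `I_δ = X - |h| + O(X / (2 L^{B'}))`
  have hn : h.natAbs ≠ 0 := Int.natAbs_ne_zero.mpr hh
  have hhX1 : (|h| : ℝ) ≤ X := by
    refine hhX.trans ?_
    calc (X : ℝ) ^ (1 - ε) ≤ (X : ℝ) ^ (1 : ℝ) := Real.rpow_le_rpow_of_exponent_le hX1 (by linarith)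
      _ = X := Real.rpow_one _
  have hhXint : |h| ≤ 2 * (X : ℤ) - X := by
    rw [two_mul, add_sub_cancel_right]
    have : ((|h| : ℤ) : ℝ) ≤ (X : ℝ) := by push_cast; exact hhX1
    exact_mod_cast this
  have hI := norm_integral_expSumIocSqKernel_sub_le (a := (X : ℤ)) (b := 2 * (X : ℤ)) hhXint hδ0 hδhalf
  have hcast : ((2 * (X : ℤ) - X - |h| : ℤ) : ℂ) = (((X : ℝ) - |(h : ℝ)| : ℝ) : ℂ) := by
    rw [← Complex.ofReal_intCast]
    push_cast
    ring
  have hδinv : 1 / (2 * δ) = X / (2 * L ^ B') := by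
    rw [hδ, hP]
    field_simp
  rw [hcast, hδinv] at hI
  -- `hI : ‖kernelIntegral X h δ - ↑(X - |h|)‖ ≤ X / (2 L^{B'})`
  -- Step 3: the singular series partial sum `Σ`
  set Sg := ∑ q ∈ Icc 1 ⌊Q⌋₊, goldbachSeriesTerm h.natAbs q with hSg
  set d := ((Nat.divisors h.natAbs).card : ℝ) with hd
  have hd1 : 1 ≤ d := by
    rw [hd]; exact_mod_cast Finset.card_pos.mpr ⟨1, Nat.one_mem_divisors.mpr hn⟩
  have hSg_abs : |Sg| ≤ K₀ * d ^ 2 :=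
    (abs_sum_le_sum_abs _ _).trans (sum_abs_goldbachSeriesTerm_le hn _)
  have hSg_tail : |goldbachSingularSeries h.natAbs - Sg| ≤ K₀ * d ^ 2 * L ^ (-A) := by
    refine (abs_goldbachSingularSeries_sub_sum_le hn hQ1).trans ?_
    rw [div_eq_mul_inv]
    refine mul_le_mul_of_nonneg_left ?_ (by positivity)
    rw [hQ, Real.sqrt_eq_rpow, ← Real.rpow_mul hL0.le, ← Real.rpow_neg hL0.le]
    exact hmono _ _ (by linarith)
  have hcastSg : (∑ q ∈ Icc 1 ⌊Q⌋₊, ((goldbachSeriesTerm h.natAbs q : ℝ) : ℂ)) = ((Sg : ℝ) : ℂ) := by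
    rw [hSg]; push_cast; rfl
  rw [hcastSg] at h1
  -- Step 4: auxiliary growth bounds
  have hLB' : (X : ℝ) / (2 * L ^ B') ≤ X * L ^ (-A) / 2 := by
    have hAB' : L ^ A ≤ L ^ B' := hmono _ _ (by linarith)
    have hLApos : 0 < L ^ A := Real.rpow_pos_of_pos hL0 _
    rw [Real.rpow_neg hL0.le, div_le_div_iff₀ (by positivity) (by norm_num)]
    -- `X * 2 ≤ X * (L^A)⁻¹ * (2 * L^B')`
    calc (X : ℝ) * 2 = X * (L ^ A)⁻¹ * (2 * L ^ A) := by
          rw [mul_comm (2 : ℝ) (L ^ A), mul_assoc, inv_mul_cancel_left₀ hLApos.ne']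
        _ ≤ X * (L ^ A)⁻¹ * (2 * L ^ B') := by
          have : 0 ≤ (X : ℝ) * (L ^ A)⁻¹ := by positivity
          exact mul_le_mul_of_nonneg_left (by linarith) this
  have hXε : (X : ℝ) ^ (1 - ε) ≤ Kε * X * L ^ (-A) := by
    have h1' : L ^ A ≤ Kε * (X : ℝ) ^ ε := hKε X hX1
    have hLApos : 0 < L ^ A := Real.rpow_pos_of_pos hL0 _
    have hXε0 : 0 < (X : ℝ) ^ ε := Real.rpow_pos_of_pos hX0 _
    rw [Real.rpow_neg hL0.le, Real.rpow_sub hX0, Real.rpow_one, div_le_iff₀ hXε0]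
    -- `X ≤ Kε X (L^A)⁻¹ X^ε` since `L^A ≤ Kε X^ε`
    calc (X : ℝ) = X * (L ^ A)⁻¹ * L ^ A := by
          rw [mul_assoc, inv_mul_cancel₀ hLApos.ne', mul_one]
      _ ≤ X * (L ^ A)⁻¹ * (Kε * (X : ℝ) ^ ε) := by
          have : 0 ≤ (X : ℝ) * (L ^ A)⁻¹ := by positivity
          exact mul_le_mul_of_nonneg_left h1' this
      _ = Kε * X * (L ^ A)⁻¹ * (X : ℝ) ^ ε := by ring
  -- Step 5: the algebraic decomposition and the four bounds
  set I := kernelIntegral X h δ with hIdef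
  set M := ∫ α in majorArcs X (L ^ B') (L ^ B), hlIntegrand X h α with hM
  set SgC : ℂ := ((Sg : ℝ) : ℂ) with hSgC'
  have hSgC : ‖SgC‖ = |Sg| := by rw [hSgC', Complex.norm_real, Real.norm_eq_abs]
  have hT1 : ‖M - SgC * I‖ ≤ C₃ * X * L ^ (-A) := h1
  have hT2 : ‖SgC * (I - (((X : ℝ) - |(h : ℝ)| : ℝ) : ℂ))‖ ≤ K₀ * d ^ 2 * (X * L ^ (-A) / 2) := by
    rw [norm_mul, hSgC]
    exact mul_le_mul hSg_abs (hI.trans hLB') (norm_nonneg _) (by positivity)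
  have hT3 : ‖SgC * ((|(h : ℝ)| : ℝ) : ℂ)‖ ≤ K₀ * d ^ 2 * (Kε * X * L ^ (-A)) := by
    rw [norm_mul, hSgC, Complex.norm_real, Real.norm_eq_abs, abs_abs]
    exact mul_le_mul hSg_abs (hhX.trans hXε) (abs_nonneg _) (by positivity)
  have hT4 : ‖(X : ℂ) * (((Sg - goldbachSingularSeries h.natAbs : ℝ)) : ℂ)‖ ≤
      X * (K₀ * d ^ 2 * L ^ (-A)) := by
    rw [norm_mul, Complex.norm_natCast, Complex.norm_real, Real.norm_eq_abs, abs_sub_comm]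
    exact mul_le_mul_of_nonneg_left hSg_tail hX0.le
  have hdecomp : M - (goldbachSingularSeries h.natAbs * X : ℂ) =
      (M - SgC * I) + SgC * (I - (((X : ℝ) - |(h : ℝ)| : ℝ) : ℂ)) - SgC * ((|(h : ℝ)| : ℝ) : ℂ) +
        (X : ℂ) * (((Sg - goldbachSingularSeries h.natAbs : ℝ)) : ℂ) := by
    rw [hSgC']; push_cast; ring
  rw [hdecomp]
  have hsum := calc
    ‖(M - SgC * I) + SgC * (I - (((X : ℝ) - |(h : ℝ)| : ℝ) : ℂ)) - SgC * ((|(h : ℝ)| : ℝ) : ℂ) +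
        (X : ℂ) * (((Sg - goldbachSingularSeries h.natAbs : ℝ)) : ℂ)‖
      ≤ ‖(M - SgC * I) + SgC * (I - (((X : ℝ) - |(h : ℝ)| : ℝ) : ℂ)) - SgC * ((|(h : ℝ)| : ℝ) : ℂ)‖ +
        ‖(X : ℂ) * (((Sg - goldbachSingularSeries h.natAbs : ℝ)) : ℂ)‖ := norm_add_le _ _
    _ ≤ ‖(M - SgC * I) + SgC * (I - (((X : ℝ) - |(h : ℝ)| : ℝ) : ℂ))‖ + ‖SgC * ((|(h : ℝ)| : ℝ) : ℂ)‖ +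
        ‖(X : ℂ) * (((Sg - goldbachSingularSeries h.natAbs : ℝ)) : ℂ)‖ := by
        gcongr; exact norm_sub_le _ _
    _ ≤ ‖M - SgC * I‖ + ‖SgC * (I - (((X : ℝ) - |(h : ℝ)| : ℝ) : ℂ))‖ + ‖SgC * ((|(h : ℝ)| : ℝ) : ℂ)‖ +
        ‖(X : ℂ) * (((Sg - goldbachSingularSeries h.natAbs : ℝ)) : ℂ)‖ := by
        gcongr; exact norm_add_le _ _
    _ ≤ C₃ * X * L ^ (-A) + K₀ * d ^ 2 * (X * L ^ (-A) / 2) + K₀ * d ^ 2 * (Kε * X * L ^ (-A)) +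
        X * (K₀ * d ^ 2 * L ^ (-A)) := add_le_add (add_le_add (add_le_add hT1 hT2) hT3) hT4
    _ = (C₃ + K₀ * (3 / 2 + Kε) * d ^ 2) * X * L ^ (-A) := by ring
  refine hsum.trans ?_
  have hXL : 0 ≤ (X : ℝ) * L ^ (-A) := by positivity
  have hcoef : C₃ + K₀ * (3 / 2 + Kε) * d ^ 2 ≤ (C₃ + K₀ * (3 / 2 + Kε)) * d ^ 2 := by
    have hd2 : 1 ≤ d ^ 2 := one_le_pow₀ hd1
    have : C₃ ≤ C₃ * d ^ 2 := le_mul_of_one_le_right hC₃0 hd2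
    linarith
  calc (C₃ + K₀ * (3 / 2 + Kε) * d ^ 2) * X * L ^ (-A)
      = (C₃ + K₀ * (3 / 2 + Kε) * d ^ 2) * (X * L ^ (-A)) := by ring
    _ ≤ ((C₃ + K₀ * (3 / 2 + Kε)) * d ^ 2) * (X * L ^ (-A)) := mul_le_mul_of_nonneg_right hcoef hXL
    _ = (C₃ + K₀ * (3 / 2 + Kε)) * d ^ 2 * X * L ^ (-A) := by ring

end PrimePairMajorArcs

open PrimePairMajorArcs

/-! ### The main theorem -/

/-- **Matomäki–Radziwiłł–Tao 2019, Prop. 3.3(i), from Prop. 4.1.** The named fact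
`MatomakiRadziwillTao2019_prop33i` (major arcs for the Hardy–Littlewood prime-pair conjecture:
`∫_𝔐 |S_{Λ1_{(X,2X]}}(α)|² e(αh) dα = 𝔖(h) X + O(d₂(h)^{O(1)} X log^{-A} X)`, obtained here with the
explicit exponent `O(1) = 2`) follows from the named fact `MatomakiRadziwillTao2019_prop41` (the
Siegel–Walfisz major-arc asymptotic for `S_{Λ1_{[1,X]}}`), by the argument printed on pp. 20–21 of
the arXiv version: pointwise approximation on the arcs (`integral_majorArcs_hlIntegrand_approx`),
the kernel computation (`norm_integral_expSumIocSqKernel_sub_le`, replacing MRT's Fourier-inversion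
step for `∫_X^{2X} e(βx)dx` by exact orthogonality for the sum kernel `T_{X,2X}`), Ramanujan sums
(`sum_integral_arcModel`) and the singular-series evaluation with its Rankin tail bound
(`hasSum_goldbachSeriesTerm`, `abs_goldbachSingularSeries_sub_sum_le`); small `X` are absorbed by
the crude bound `norm_integral_majorArcs_sub_le_crude`.
[cite: MatomakiRadziwillTao2019, Prop. 3.3(i), p. 18, proof pp. 20–21 (arXiv)] -/
theorem MatomakiRadziwillTao2019_prop33i_of_prop41 (h41 : MatomakiRadziwillTao2019_prop41) :
    MatomakiRadziwillTao2019_prop33i := by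
  intro A ε B B' hA hε _hε2 hAB hBB
  obtain ⟨X₀, C, hC0, hlarge⟩ := prop33i_large h41 hA hε hAB hBB
  obtain ⟨K, hK0, hcrude⟩ := norm_integral_majorArcs_sub_le_crude
  set X₁ := max X₀ 2 with hX₁
  set L₁ := Real.log X₁ with hL₁
  have hX₁2 : 2 ≤ X₁ := le_max_right _ _
  have hL₁0 : 0 < L₁ := Real.log_pos (by linarith)
  have hL₁A : 0 ≤ L₁ ^ A := Real.rpow_nonneg hL₁0.le _
  refine ⟨C + K * X₁ * L₁ ^ A, 2, fun X hX h hh hhX ↦ ?_⟩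
  change ‖(∫ α in majorArcs X (Real.log X ^ B') (Real.log X ^ B), hlIntegrand X h α) -
      (goldbachSingularSeries h.natAbs * X : ℂ)‖ ≤ _
  rw [Real.rpow_two]
  set d := ((Nat.divisors h.natAbs).card : ℝ) with hd
  have hX2 : (2 : ℝ) ≤ X := by exact_mod_cast hX
  have hX0 : (0 : ℝ) < X := by linarith
  have hL0 : 0 < Real.log X := Real.log_pos (by linarith)
  have hLA : 0 ≤ Real.log X ^ (-A) := Real.rpow_nonneg hL0.le _
  have hd0 : 0 ≤ d := by positivity
  have hbase : 0 ≤ d ^ 2 * X * Real.log X ^ (-A) := by positivity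
  rcases le_or_gt X₁ X with hbig | hsmall
  · -- large `X`
    refine (hlarge X ((le_max_left _ _).trans hbig) h hh hhX).trans ?_
    have hCle : C ≤ C + K * X₁ * L₁ ^ A := by
      have : 0 ≤ K * X₁ * L₁ ^ A := by positivity
      linarith
    calc C * d ^ 2 * X * Real.log X ^ (-A) = C * (d ^ 2 * X * Real.log X ^ (-A)) := by ring
      _ ≤ (C + K * X₁ * L₁ ^ A) * (d ^ 2 * X * Real.log X ^ (-A)) :=
          mul_le_mul_of_nonneg_right hCle hbase
      _ = (C + K * X₁ * L₁ ^ A) * d ^ 2 * X * Real.log X ^ (-A) := by ring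
  · -- small `X`: crude bound
    refine (hcrude X (by omega) _ _ h hh).trans ?_
    have hXX₁ : (X : ℝ) ≤ X₁ := hsmall.le
    have hLL : Real.log X ≤ L₁ := Real.log_le_log hX0 hXX₁
    have hpow : 1 ≤ L₁ ^ A * Real.log X ^ (-A) := by
      rw [Real.rpow_neg hL0.le, ← div_eq_mul_inv, le_div_iff₀ (Real.rpow_pos_of_pos hL0 _), one_mul]
      exact Real.rpow_le_rpow hL0.le hLL hA.le
    have hstep : K * d ^ 2 * (X : ℝ) ^ 2 ≤ (K * X₁ * L₁ ^ A) * d ^ 2 * X * Real.log X ^ (-A) := by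
      have h0 : 0 ≤ K * d ^ 2 * (X : ℝ) := by positivity
      calc K * d ^ 2 * (X : ℝ) ^ 2 = (K * d ^ 2 * X) * X * 1 := by ring
        _ ≤ (K * d ^ 2 * X) * X₁ * (L₁ ^ A * Real.log X ^ (-A)) := by
            refine mul_le_mul (mul_le_mul_of_nonneg_left hXX₁ h0) hpow zero_le_one ?_
            positivity
        _ = (K * X₁ * L₁ ^ A) * d ^ 2 * X * Real.log X ^ (-A) := by ring
    refine hstep.trans ?_
    have hKle : K * X₁ * L₁ ^ A ≤ C + K * X₁ * L₁ ^ A := by linarith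
    calc (K * X₁ * L₁ ^ A) * d ^ 2 * X * Real.log X ^ (-A)
        = (K * X₁ * L₁ ^ A) * (d ^ 2 * X * Real.log X ^ (-A)) := by ring
      _ ≤ (C + K * X₁ * L₁ ^ A) * (d ^ 2 * X * Real.log X ^ (-A)) :=
          mul_le_mul_of_nonneg_right hKle hbase
      _ = (C + K * X₁ * L₁ ^ A) * d ^ 2 * X * Real.log X ^ (-A) := by ring

/-- **MRT Prop. 3.3(i) from the Siegel–Walfisz theorem.** Composition of
`MatomakiRadziwillTao2019_prop33i_of_prop41` (this file: MRT's printed proof, pp. 20–21) with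
`MatomakiRadziwillTao2019_prop41_of_siegelWalfisz` (`CircleMethodMajorArcsProofs.lean`: MRT Prop. 4.1
from `Literature.NumberTheory.Sieve.siegel_walfisz` by Nathanson's Lemmas 8.2–8.3). This is the full unconditional
content available today: the vendored Siegel–Walfisz theorem (parity.S28) is the only undischarged
input. [cite: MatomakiRadziwillTao2019, Prop. 3.3(i) p. 18 and Prop. 4.1 p. 20 (arXiv)] -/
theorem MatomakiRadziwillTao2019_prop33i_of_siegelWalfisz (hSW : Literature.NumberTheory.Sieve.siegel_walfisz) :
    MatomakiRadziwillTao2019_prop33i :=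
  MatomakiRadziwillTao2019_prop33i_of_prop41 (MatomakiRadziwillTao2019_prop41_of_siegelWalfisz hSW)

/-! ### The dyadic form of Prop. 4.1, as printed -/

/-- **Matomäki–Radziwiłł–Tao 2019, Prop. 4.1, dyadic form as printed** ("and hence also
`S_{Λ1_{(X,2X]}}(α) = μ(q)/φ(q) ∫_X^{2X} e(βx) dx + O_{A,B,B'}(X log^{-A} X)`" for `X ≥ 2`,
`1 ≤ q ≤ log^B X`, `(a,q) = 1`, `|β| ≤ log^{B'} X / X`), derived from the named fact
`MatomakiRadziwillTao2019_prop41` (the `[1, X]` display): the sum-kernel version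
`primeExpSumDyadic_approx` (`X ≥ 4`) plus `|T_{X,2X}(β) - ∫_X^{2X} e(βx) dx| ≤ 2π|β|X ≤ 2π log^{B'} X`
(`Literature.NumberTheory.Sieve.norm_expSumIoc_sub_integral_le`), absorbed via `log^{A+B'} X ≤ K X`; the finitely many
`X ∈ {2, 3}` are covered by the trivial bound `|S| + |∫| ≤ (log 4 + 4)·2X + X`.
[cite: MatomakiRadziwillTao2019, Prop. 4.1 (second display), p. 20 (arXiv)] -/
theorem MatomakiRadziwillTao2019_prop41_dyadic (h41 : MatomakiRadziwillTao2019_prop41) :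
    ∀ A B B' : ℝ, 0 < A → 0 < B → 0 < B' →
    ∃ C : ℝ, ∀ X : ℕ, 2 ≤ X → ∀ q : ℕ, 1 ≤ q → (q : ℝ) ≤ Real.log X ^ B →
      ∀ a : ℤ, Int.gcd a q = 1 → ∀ β : ℝ, |β| ≤ Real.log X ^ B' / X →
        ‖primeExpSumDyadic X (a / q + β)
            - ((μ q : ℝ) / (Nat.totient q : ℝ) : ℂ) * ∫ x in (X : ℝ)..(2 * X : ℕ), (𝐞 (β * x) : ℂ)‖
          ≤ C * X * Real.log X ^ (-A) := by
  intro A B B' hA hB hB'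
  obtain ⟨C₁, hC₁⟩ := primeExpSumDyadic_approx h41 hA hB hB'
  obtain ⟨K, hK, hKle⟩ := exists_log_rpow_le_rpow (k := A + B') (by linarith) one_pos
  refine ⟨max C₁ 0 + 2 * Real.pi * K + (2 * (Real.log 4 + 4) + 1) * 2 ^ A,
    fun X hX q hq hqB a ha β hβ ↦ ?_⟩
  have hX2 : (2 : ℝ) ≤ X := by exact_mod_cast hX
  have hX0 : (0 : ℝ) < X := by linarith
  set L := Real.log X with hL
  have hL0 : 0 < L := Real.log_pos (by linarith)
  have hLA : 0 < L ^ (-A) := Real.rpow_pos_of_pos hL0 _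
  have hl4 : 0 < Real.log 4 := Real.log_pos (by norm_num)
  have h2A : (1 : ℝ) ≤ 2 ^ A := Real.one_le_rpow (by norm_num) hA.le
  set m : ℂ := ((μ q : ℝ) / (Nat.totient q : ℝ) : ℂ) with hm
  have hm1 : ‖m‖ ≤ 1 := norm_moebius_div_totient_le q
  -- the integral in the statement, with `ℤ`-cast endpoints as in `norm_expSumIoc_sub_integral_le`
  have hI : (∫ x in (X : ℝ)..((2 * X : ℕ) : ℝ), (𝐞 (β * x) : ℂ)) =
      ∫ x in ((X : ℤ) : ℝ)..((2 * (X : ℤ) : ℤ) : ℝ), (𝐞 (β * x) : ℂ) := by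
    push_cast; rfl
  have hIle : ‖∫ x in (X : ℝ)..((2 * X : ℕ) : ℝ), (𝐞 (β * x) : ℂ)‖ ≤ X := by
    refine (intervalIntegral.norm_integral_le_of_norm_le_const (C := 1)
      fun x _ ↦ (Circle.norm_coe _).le).trans ?_
    push_cast
    rw [one_mul, show (2 * (X : ℝ)) - X = X by ring, abs_of_pos hX0]
  have hbase : 0 ≤ (X : ℝ) * L ^ (-A) := by positivity
  rcases le_or_gt 4 X with h4 | h4
  · -- `X ≥ 4`: sum kernel + `|T - ∫| ≤ 2π|β|X ≤ 2π L^{B'} ≤ 2πK X L^{-A}`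
    have h1 := hC₁ X h4 q hq hqB a ha β hβ
    have hT : ‖expSumIoc X (2 * X) β - ∫ x in (X : ℝ)..((2 * X : ℕ) : ℝ), (𝐞 (β * x) : ℂ)‖ ≤
        2 * Real.pi * |β| * X := by
      rw [hI]
      have := norm_expSumIoc_sub_integral_le (a := (X : ℤ)) (b := 2 * (X : ℤ)) (by omega) β
      push_cast at this ⊢
      convert this using 1; ring
    have hβX : |β| * X ≤ L ^ B' := by
      rw [le_div_iff₀ hX0] at hβ; exact hβ
    have hLB : L ^ B' ≤ K * X * L ^ (-A) := by
      have h := hKle X (by linarith)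
      rw [Real.rpow_one] at h
      have : L ^ B' = L ^ (A + B') * L ^ (-A) := by
        rw [← Real.rpow_add hL0]; ring_nf
      rw [this]
      exact mul_le_mul_of_nonneg_right h hLA.le
    have hA1 : ‖primeExpSumDyadic X (a / q + β) - m * expSumIoc X (2 * X) β‖ ≤
        max C₁ 0 * X * L ^ (-A) :=
      h1.trans (mul_le_mul_of_nonneg_right (mul_le_mul_of_nonneg_right (le_max_left _ _) hX0.le)
        hLA.le)
    have hA2 : ‖m * (expSumIoc X (2 * X) β - ∫ x in (X : ℝ)..((2 * X : ℕ) : ℝ), (𝐞 (β * x) : ℂ))‖ ≤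
        2 * Real.pi * (K * X * L ^ (-A)) := by
      rw [norm_mul]
      calc ‖m‖ * ‖expSumIoc X (2 * X) β - ∫ x in (X : ℝ)..((2 * X : ℕ) : ℝ), (𝐞 (β * x) : ℂ)‖
          ≤ 1 * (2 * Real.pi * |β| * X) :=
            mul_le_mul hm1 hT (norm_nonneg _) zero_le_one
        _ = 2 * Real.pi * (|β| * X) := by ring
        _ ≤ 2 * Real.pi * L ^ B' := by gcongr
        _ ≤ 2 * Real.pi * (K * X * L ^ (-A)) := by gcongr
    calc ‖primeExpSumDyadic X (a / q + β) - m * ∫ x in (X : ℝ)..((2 * X : ℕ) : ℝ), (𝐞 (β * x) : ℂ)‖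
        ≤ ‖primeExpSumDyadic X (a / q + β) - m * expSumIoc X (2 * X) β‖ +
            ‖m * (expSumIoc X (2 * X) β - ∫ x in (X : ℝ)..((2 * X : ℕ) : ℝ), (𝐞 (β * x) : ℂ))‖ := by
          rw [mul_sub]; exact norm_sub_le_norm_sub_add_norm_sub _ _ _
      _ ≤ max C₁ 0 * X * L ^ (-A) + 2 * Real.pi * (K * X * L ^ (-A)) := add_le_add hA1 hA2
      _ = (max C₁ 0 + 2 * Real.pi * K) * (X * L ^ (-A)) := by ring
      _ ≤ (max C₁ 0 + 2 * Real.pi * K + (2 * (Real.log 4 + 4) + 1) * 2 ^ A) * (X * L ^ (-A)) :=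
          mul_le_mul_of_nonneg_right (le_add_of_nonneg_right (by positivity)) hbase
      _ = _ := by ring
  · -- `X ∈ {2, 3}`: trivial bound
    have hX3 : (X : ℝ) ≤ 3 := by exact_mod_cast (by omega : X ≤ 3)
    have hL2 : L ≤ 2 := by
      calc L ≤ Real.log 4 := Real.log_le_log hX0 (by linarith)
        _ = 2 * Real.log 2 := by
            rw [show (4 : ℝ) = 2 ^ 2 by norm_num, Real.log_pow]; norm_num
        _ ≤ 2 := by have := Real.log_two_lt_d9; linarith
    have hpow : 1 ≤ 2 ^ A * L ^ (-A) := by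
      rw [Real.rpow_neg hL0.le, ← div_eq_mul_inv, le_div_iff₀ (Real.rpow_pos_of_pos hL0 _),
        one_mul]
      exact Real.rpow_le_rpow hL0.le hL2 hA.le
    have hB1 : ‖m * ∫ x in (X : ℝ)..((2 * X : ℕ) : ℝ), (𝐞 (β * x) : ℂ)‖ ≤ 1 * X := by
      rw [norm_mul]; exact mul_le_mul hm1 hIle (norm_nonneg _) zero_le_one
    calc ‖primeExpSumDyadic X (a / q + β) - m * ∫ x in (X : ℝ)..((2 * X : ℕ) : ℝ), (𝐞 (β * x) : ℂ)‖
        ≤ ‖primeExpSumDyadic X (a / q + β)‖ +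
            ‖m * ∫ x in (X : ℝ)..((2 * X : ℕ) : ℝ), (𝐞 (β * x) : ℂ)‖ := norm_sub_le _ _
      _ ≤ (Real.log 4 + 4) * (2 * X) + 1 * X := add_le_add (norm_primeExpSumDyadic_le X _) hB1
      _ = (2 * (Real.log 4 + 4) + 1) * X * 1 := by ring
      _ ≤ (2 * (Real.log 4 + 4) + 1) * X * (2 ^ A * L ^ (-A)) := by gcongr
      _ = ((2 * (Real.log 4 + 4) + 1) * 2 ^ A) * (X * L ^ (-A)) := by ring
      _ ≤ (max C₁ 0 + 2 * Real.pi * K + (2 * (Real.log 4 + 4) + 1) * 2 ^ A) * (X * L ^ (-A)) :=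
          mul_le_mul_of_nonneg_right (le_add_of_nonneg_left (by positivity)) hbase
      _ = _ := by ring

end Literature.NumberTheory.Sieve

end
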